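import Literature.Barriers.ABC.UniformABCImpliesNoSiegelZeros
import Literature.NumberTheory.DiophantineGeometry.AbcWave0GranvilleStarkHeightProofs
import Literature.NumberTheory.DiophantineGeometry.AbcWave0GranvilleStarkEq11Proofs
import Literature.NumberTheory.DiophantineGeometry.AbcWave0GranvilleStarkTheorem1UnramifiedProofs
import Literature.NumberTheory.EllipticCurves.SingularModuliHilbertClassField
import Literature.NumberTheory.EllipticCurves.SingularModuliHilbertClassFieldRange
import Literature.NumberTheory.EllipticCurves.SingularModuliWeberCubeRootInert
import Literature.NumberTheory.EllipticCurves.SingularModuliWeberSquareRootInert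
import Literature.NumberTheory.EllipticCurves.SingularModuliSquareAwayFromThree
import Literature.NumberTheory.NumberFields.FrobeniusClassGroupUnramified
import Literature.NumberTheory.NumberFields.HilbertClassFieldOfCharacters
import HarnessLib

/-!
# Barrier (ABC), `O`-weak form: the reduction of `OWeakUniformABCImpliesNoSiegelZeros` to the
# complex-multiplication datum and Granville–Stark's eq. (11), proved

`Literature/Barriers/ABC/UniformABCImpliesNoSiegelZerosProofs.lean` — a proofs-only sibling
(theorems only: no definitions, no named facts, D-0026) of the barrier catalogue entry
`Literature.Barriers.ABC.OWeakUniformABCImpliesNoSiegelZeros`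
(`UniformABCImpliesNoSiegelZeros.lean`): the `O`-weak / discriminant-power uniform abc conjecture
over number fields — for every `ε > 0` constants `A, C` with
`H_K(a:b:c) < C^{[K:ℚ]} · |D_K|^A · N_K(a,b,c)^{1+ε}` for all number fields `K` and all nonzero
`a + b = c` in `K` [Tafula2021, Conjecture 5.2 (i)]; [GranvilleStark2000, §1: "replace `Δ_K` by
`Δ_K^A`"] — implies `Literature.NumberTheory.DiophantineGeometry.NoSiegelZerosOddQuadratic`
[Tafula2021, Theorem 1.2] [GranvilleStark2000, Theorem 2].

## What is proved here

The printed proof ([Tafula2021, §5.2]; [GranvilleStark2000, §2–§3]) has three inputs: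

1. the height argument: abc in a field `K ∋ γ₂(τ_D), γ₃(τ_D)` applied to
   `γ₂³ − γ₃² = 1728` bounds the height of the singular modulus `j(τ_D) = γ₂³`
   [Tafula2021, Lemma 5.5] [GranvilleStark2000, §2 (5′)–(6)], whose conjugates `j(τ_Q)`,
   `Q` reduced of discriminant `D`, have `log max(1,|j(τ_Q)|) = π√|D|/a_Q + O(1)`
   [GranvilleStark2000, §2 (7)];
2. the complex-multiplication datum [Tafula2021, Lemma 5.4] = [GranvilleStark2000, Lemma 1]:
   `𝓛 = ℚ(γ₂(τ_D), γ₃(τ_D)) ⊇ ℚ(√D, j(τ_D))` has root discriminant `rd_𝓛 ≤ 6√|D|` — "the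
   particular factor of "6" plays little role here, since it would be enough to have
   `rd_𝓛 ≪_ε |D|^{1/2+ε}`" [Tafula2021, after Lemma 5.4]; for the `O`-weak form ANY polynomial
   bound `rd_𝓛 ≤ (B|D|)^E` suffices, and that is the shape used below;
3. the analytic conversion of the resulting class-number / height bound into
   `L′/L(1, χ_D) ≪ log|D|` — [Tafula2021, Theorem 1.1] via Duke's theorem, or
   [GranvilleStark2000, §3.2 eq. (11)] (Selberg–Chowla + Dirichlet's class number formula) — and
   Mahler's "`L′/L(1,χ) ≪ log d` ⟺ no Siegel zero" [GranvilleStark2000, §3.1 Remark 1].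

Input 1 and the last equivalence of input 3 are PROVED in the tree for the full conjecture
(`Literature.NumberTheory.DiophantineGeometry.pi_mul_sqrt_mul_sum_inv_le_of_uniformABC`,
`…noSiegelZerosOddQuadratic_of_eventually_logDeriv_le`); this file proves them for the `O`-weak
hypothesis and assembles:

* `pi_mul_sqrt_mul_sum_inv_le_of_oWeakABC` — **the height argument under `O`-weak abc**
  ([Tafula2021, Lemma 5.5 and proof of Theorem 1.3]; [GranvilleStark2000, §1 "if we were to replace
  `Δ_K` by `Δ_K^A` … analogous, though slightly weaker, results"]): under the `O`-weak hypothesis,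
  for all constants `B ≥ 1`, `E ≥ 0` there are `κ ≥ 0`, `C₀` with
  `π√|D| ∑_{Q reduced} 1/a_Q ≤ h(D)(κ log|D| + C₀)` for every discriminant `D < 0` and every
  number field `K ∋ g₂, g₃` (algebraic integers, `ι(g₂)³ = j(τ_D) = ι(g₃)² + 1728`) with
  `|D_K| ≤ (B|D|)^{E[K:ℚ]}`; all the arithmetic of heights, conductors and conjugates is the tree's
  (`radicalNorm_le_of_sq_of_cube`, `natAbs_norm_pow_three_le`, `natAbs_norm_sq_le`,
  `prod_max_pow_le_mulHeight`, `classNumber_mul_sum_embeddings_eq`,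
  `pi_mul_sqrt_div_sub_le_log_norm_formJ`, `theorem1_arith`);
* `oWeak_classNumber_bound_of_cmData` — hence a class-number bound
  `c (√d/log d) ∑ 1/a ≤ h(−d)` with SOME `c > 0` for all large `d` carrying an odd real primitive
  character (Granville–Stark's Theorem 1 with `π/3` replaced by an unspecified positive constant,
  [GranvilleStark2000, §1]; [Tafula2021, §5.2: `limsup ht(j(τ_D))/log|D| < ∞`]);
* `logDeriv_le_of_classNumber_bounds_const` — the real-variable step of [GranvilleStark2000, §3.1
  Remark 1] for an arbitrary constant `c > 0` in place of `π/6`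
  (the tree's `logDeriv_le_of_classNumber_bounds` is the case `c = π/6`);
* `OWeakUniformABCImpliesNoSiegelZeros.of_cmData_of_eq11` — **the barrier entry from the CM datum
  (polynomial form) and eq. (11)**; and `OWeakUniformABCImpliesNoSiegelZeros.of_lemma1Data_of_eq11`
  — the same from the two hypotheses, verbatim, of the tree's
  `Literature.NumberTheory.DiophantineGeometry.granville_stark_noSiegelZeros_of_lemma1Data_of_eq11`,
  so that one proof of those two displayed statements discharges `granville_stark_noSiegelZeros`,
  `UniformABCImpliesNoSiegelZeros` AND `OWeakUniformABCImpliesNoSiegelZeros`.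

## Update (2026-08-15, session 2): eq. (11) proved; one hypothesis left, shared with abc.S22

Eq. (11) is now a theorem of the tree (`Literature.NumberTheory.DiophantineGeometry.granvilleStark_eq11`,
`AbcWave0GranvilleStarkEq11Proofs.lean`), so the last section of this file derives the entry from the
CM datum ALONE, in the successively weaker forms under which the tree has meanwhile reduced
Granville–Stark's Lemma 1 for `granville_stark` and `granville_stark_noSiegelZeros`
(`AbcWave0GranvilleStarkTheorem1{Lemma1,HilbertKummer,Unramified}Proofs.lean`, whose proved Kummer
step `exists_kummer_tower` and unramified-discriminant formula
`Literature.NumberTheory.NumberFields.natAbs_discr_eq_pow_of_forall_isUnramifiedAt` are reused):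
`OWeakUniformABCImpliesNoSiegelZeros.of_cmData` (polynomial datum), `.of_discrBoundPoly`
(over imaginary quadratic fields, `u, v` not assumed integral), `.of_cmInput` (verbatim the `H` of
`granville_stark_of_cmInput` / `granville_stark_noSiegelZeros_of_cmInput`),
`.of_hilbert_cubeSquare_poly` (`(j₀) = 𝔞³`, `(j₀ − 1728) = 𝔟²` as ideals, polynomial discriminant),
`.of_unramified_cubeSquare` (verbatim the hypothesis of `granville_stark_of_unramified_cubeSquare`),
and `UniformABCImpliesNoSiegelZeros.of_unramified_cubeSquare`.

## Update (2026-08-15, session 2, cont.): (U) from the Hilbert class field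

`OWeakUniformABCImpliesNoSiegelZeros.of_hilbertClassField_of_cubeSquare` (and the analogues for
`UniformABCImpliesNoSiegelZeros` and `granville_stark`): the hypothesis of `.of_unramified_cubeSquare`
is split into (HCF) the Hilbert class field of imaginary quadratic fields (class field theory) and
(C) the cube/square structure of `(j(τ_D))`, `(j(τ_D) − 1728)` (complex multiplication), through the
tree's `Literature.NumberTheory.EllipticCurves.exists_unramified_formJ_of_hilbertClassField`
(the containment `K(j(τ_D)) ⊆ H` from the splitting of principal-form primes, Bauer's theorem and the
norm form — all proved).

`OWeakUniformABCImpliesNoSiegelZeros.of_classField_of_cubeSquare` (and analogues): (HCF) is in turn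
derived (`Literature.NumberTheory.NumberFields.exists_hilbertClassField_data_of_classField`, via the
tree's proved Artin reciprocity) from (HCF′) the EXISTENCE of a finite abelian `E/K` with an injective
`Φ : Cl(𝓞_K) → Gal(E/K)`, `Frob_v = Φ([v])` for almost all `v` — the class field of `Kˣ·U_K`, i.e. the
output of the existence theorem of global class field theory.

`OWeakUniformABCImpliesNoSiegelZeros.of_cubeSquare` (and analogues): (HCF) is DISCHARGED by
`Literature.NumberTheory.NumberFields.exists_hilbertClassField_data` (the Hilbert class field of
every number field from the tree's proved global class field theory), so the entry follows from the
cube/square datum (C) ALONE.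

`OWeakUniformABCImpliesNoSiegelZeros.of_cubeSquare_canonical`: (C) reduced (`cubeSquare_of_canonical`)
to its canonical instance — the ideals `(j(τ_{d_K}))`, `(j(τ_{d_K}) − 1728)` of the ring of integers
of the one subfield `ℚ(j(τ_{d_K}), i√|d_K|) ⊂ ℂ`.

`OWeakUniformABCImpliesNoSiegelZeros.of_cubeSquare_singularModuliField` (section SingularModuliField):
(C) in its **H_K-form** — the ideals `(j₁)`, `(j₁ − 1728)` of the ring of integers of the concrete
field of singular moduli `H_K = singularModuliField K ι ⊂ ℂ` are a cube and a square — moved onto the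
Hilbert class field through `SingularModuliHilbertClassFieldRange` (the embedding `σ : H → ℂ` covers
`H_K`).  In this form (C) is PROVED in the tree for `gcd(d_K, 6) = 1`
(`cubeSquare_singularModuliField_of_coprime_six`, section CoprimeSix): the cube part for all
`3 ∤ d_K` (`exists_span_formJ_eq_pow_three_of_not_dvd`, Cox Thm. 12.2 with the inert case by Cox's
degree argument) and the square part for all odd `d_K` (`exists_span_formJ_sub_eq_sq_of_odd`, Weber's
`γ₃` through level `4` and an odd-degree trick), `Literature/NumberTheory/EllipticCurves/SingularModuliWeber*`.
Whence `OWeakUniformABCImpliesNoSiegelZeros.of_cubeSquare_singularModuliField_two_three`: the fact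
from (C_H) for the discriminants divisible by `2` or `3` ALONE.

## Status: `OWeakUniformABCImpliesNoSiegelZeros_holds` is PROVED (section AllDiscriminants)

The last input, (C_H) at the discriminants divisible by `2` or `3`, is supplied by the ring class fields
of conductor `2` and `3` in H_K-form (`Literature/NumberTheory/EllipticCurves/SingularModuli{RingClassUnramified,
CubeSquareAwayFromSix,CubeAwayFromTwo,SquareAwayFromThree}.lean`): Deuring's congruence `π ≡ 1 (mod f)`
for the principal primes below the split primes of the field of moduli of discriminant `f²d_K`, class
field theory for ray class characters (`RayClassFieldOfCharacters`) and Bauer's theorem make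
`H_K(j(τ_Q))/H_K` unramified outside `f`; Weber's `γ₂` (level `9`), `γ₃` (level `4`) and the
Hauptmoduln `s = Δ(τ)/Δ(2τ)` of `X₀(2)` (`j(2τ)s = (s + 16)³`) and `t = (η/η₃)¹²` of `X₀(3)`
(`(j(3τ) − 1728)t = (t² + 18t − 27)²`), transported to CM points and integral, then give
`3 ∣ v_𝔓(j₁)` and `2 ∣ v_𝔓(j₁ − 1728)` prime by prime (`e = 1` below the relevant prime).  Hence
`cubeSquare_singularModuliField` (all `d_K`), `OWeakUniformABCImpliesNoSiegelZeros_holds`,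
`UniformABCImpliesNoSiegelZeros_holds` and `granville_stark_of_cubeSquare_all`.

## References

* [Tafula2021] C. Táfula, *On Landau–Siegel zeros and heights of singular moduli*, Acta Arith.
  201 (2021), 1–28 (arXiv:1911.07215, whose numbering is used): Theorem 1.2, §5.1 Conjectures
  5.1–5.2, §5.2 Lemma 5.4, Lemma 5.5 and the proof of Theorem 1.3 (PDF p. 12).
* [GranvilleStark2000] A. Granville, H. M. Stark, *ABC implies no "Siegel zeros" for
  `L`-functions of characters with negative discriminant*, Invent. Math. 139 (2000), 509–523:
  §1 (the `Δ_K^A` remark), §2 (Lemma 1, (5′)–(7)), §3.1 Remark 1, §3.2 eq. (11).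
* [Cox2013] D. A. Cox, *Primes of the form x² + ny²*, 2nd ed., Wiley 2013: Thm. 11.1, Thm. 12.2.
* [NeukirchANT1999] J. Neukirch, *Algebraic Number Theory*, Springer 1999, Ch. III (2.6), (2.9), (2.10).
* [BombieriGubler2006] E. Bombieri, W. Gubler, *Heights in Diophantine Geometry*, CUP 2006, App. B
  Lemma B.2.6 (through the tree's `exists_kummer_tower`).

## Tree / Mathlib search

Everything used is listed above; `lean search 'oWeak|OWeak'` finds only the barrier file and this one;
`lean search 'of_unramified_cubeSquare|of_hilbert_cubeSquare|granvilleStark_eq11'` (session 2) gave the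
reused theorems.
Nothing is restated as a definition; no named fact is introduced (D-0026).
-/

noncomputable section

namespace Literature.Barriers.ABC

open Literature.NumberTheory.DiophantineGeometry
open _root_.Literature.NumberTheory.EllipticCurves
open _root_.Literature.NumberTheory.QuadraticFields.BinaryQuadraticForm
open _root_.Literature.NumberTheory.LFunctions.PrimitiveQuadratic
open scoped NumberField

/-! ### The height argument under the `O`-weak hypothesis -/

section HeightArgument

open NumberField

/-- Numerics: if `d > 32` and `π√d − 10 ≤ log max(1, |z|)` then `|z| > 1728`
(`π√32 − 10 > 7.7 > log 1728`). [folklore] -/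
theorem norm_gt_of_pi_mul_sqrt_sub_le {d : ℝ} {z : ℂ} (hd : 32 < d)
    (hz : Real.pi * √d - 10 ≤ Real.log (max 1 ‖z‖)) : (1728 : ℝ) < ‖z‖ := by
  have hsqrt32 : (5.6 : ℝ) < √d := by
    rw [show (5.6 : ℝ) = √(5.6 ^ 2) by rw [Real.sqrt_sq (by norm_num)]]
    exact Real.sqrt_lt_sqrt (by norm_num) (by nlinarith)
  have hpi3 : (3.14 : ℝ) < Real.pi := Real.pi_gt_d2
  have h1 : (7.5 : ℝ) < Real.log (max 1 ‖z‖) := by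
    have hsq0 : 0 ≤ √d - 5.6 := by linarith
    have hpi0 : 0 ≤ Real.pi - 3.14 := by linarith
    nlinarith [mul_nonneg hpi0 hsq0]
  have h2 : Real.log 1728 < 7.5 := by
    have h15 : Real.log ((1728 : ℝ) ^ 2) < 15 := by
      rw [Real.log_lt_iff_lt_exp (by norm_num)]
      have := Real.exp_one_gt_d9
      have h8 : Real.exp 15 = Real.exp 1 ^ 15 := by rw [← Real.exp_nat_mul]; norm_num
      rw [h8]
      have : (1728 : ℝ) ^ 2 < (2.7182818283 : ℝ) ^ 15 := by norm_num
      have h27 : (2.7182818283 : ℝ) ^ 15 ≤ Real.exp 1 ^ 15 := by gcongr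
      linarith
    rw [Real.log_pow] at h15
    push_cast at h15
    linarith
  have h3 : Real.log 1728 < Real.log (max 1 ‖z‖) := by linarith
  have h4 : (1728 : ℝ) < max 1 ‖z‖ := by
    rwa [Real.log_lt_log_iff (by norm_num) (lt_of_lt_of_le one_pos (le_max_left _ _))] at h3
  rcases le_total 1 ‖z‖ with hle | hle
  · rwa [max_eq_right hle] at h4
  · rw [max_eq_left hle] at h4; linarith

/-- **The height argument of Granville–Stark / Táfula under `O`-weak uniform abc.** Assume the
`O`-weak uniform abc conjecture (the hypothesis of `OWeakUniformABCImpliesNoSiegelZeros`: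
`H_K < C^{[K:ℚ]} |D_K|^A N_K^{1+ε}`) and let `B ≥ 1`, `E ≥ 0`. There are constants `κ ≥ 0` and `C₀`
such that for every discriminant `D < 0`, `D ≡ 0, 1 (mod 4)`, every number field `K` with a complex
embedding `ι` and all algebraic integers `g₂, g₃ ∈ 𝓞 K` with `ι(g₂)³ = j(τ_P)`,
`ι(g₃)² = j(τ_P) − 1728` (`P` the principal form of discriminant `D`; `γ₃² − γ₂³ + 1728 = 0`,
[GranvilleStark2000, (5′)]) whose discriminant satisfies `|D_K| ≤ (B|D|)^{E[K:ℚ]}` (root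
discriminant `≤ (B|D|)^E`), one has `π√|D| · ∑_{Q reduced of disc D} 1/a_Q ≤ h(D)(κ log|D| + C₀)`.
This is [Tafula2021, Lemma 5.5] (`ht(j(τ_D)) < (1−5ε)⁻¹((1+ε)·3 log|D| + 6𝒞) + O(1)`, here at
`ε = 1/10` and with `𝒞 = (A−1−ε) log rd_K + log C`, `log rd_K ≤ E log(B|D|)`) combined with the
lower bound `log max(1,|j(τ_Q)|) ≥ π√|D|/a_Q − 10` for the conjugates; equivalently Granville–Stark's
proof of Theorem 1 with "`Δ_K` replaced by `Δ_K^A`" [GranvilleStark2000, §1]. The proof is the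
tree's `pi_mul_sqrt_mul_sum_inv_le_of_uniformABC` with the abc step and the discriminant step
changed. [cite: Tafula2021, Lemma 5.5 and §5.2 (proof of Theorem 1.3)] -/
theorem pi_mul_sqrt_mul_sum_inv_le_of_oWeakABC
    (habc : ∀ ε : ℝ, 0 < ε → ∃ A C : ℝ, ∀ (K : Type) [Field K] [NumberField K] (a b c : K),
      a ≠ 0 → b ≠ 0 → c ≠ 0 → a + b = c →
        Height.mulHeight ![a, b, c] <
          C ^ Module.finrank ℚ K * (|NumberField.discr K| : ℝ) ^ A *
            (radicalNorm a b c : ℝ) ^ (1 + ε))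
    {B E : ℝ} (hB : 1 ≤ B) (hE : 0 ≤ E) :
    ∃ κ C₀ : ℝ, 0 ≤ κ ∧ ∀ (D : ℤ), D < 0 → (D % 4 = 0 ∨ D % 4 = 1) →
      ∀ (K : Type) [Field K] [NumberField K] (ι : K →+* ℂ) (g₂ g₃ : 𝓞 K),
        ι (g₂ : K) ^ 3 = formJ (principalForm D) →
        ι (g₃ : K) ^ 2 = formJ (principalForm D) - 1728 →
        |(NumberField.discr K : ℝ)| ≤ (B * |(D : ℝ)|) ^ (E * (Module.finrank ℚ K : ℝ)) →
        Real.pi * √(-(D : ℝ)) * ∑ Q ∈ reducedForms D, (1 : ℝ) / Q.1 ≤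
          classNumber D * (κ * Real.log (-(D : ℝ)) + C₀) := by
  classical
  -- the abc constants at `ε = 1/10` (kept as an opaque real `ε` with `0 < ε < 1/5`)
  obtain ⟨ε, hε, hε5⟩ : ∃ ε : ℝ, 0 < ε ∧ ε < 1 / 5 := ⟨1 / 10, by norm_num, by norm_num⟩
  have hε1 : 0 < 1 + ε := by linarith
  have hκ : 0 < 1 - 5 * ε := by linarith
  obtain ⟨A, C, hC⟩ := habc ε hε
  set C' : ℝ := max |C| 1 with hC'def
  have hC'1 : 1 ≤ C' := le_max_right _ _
  have hC'0 : 0 < C' := one_pos.trans_le hC'1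
  set A' : ℝ := max A 0 with hA'def
  have hA'0 : 0 ≤ A' := le_max_right _ _
  have hB0 : 0 < B := one_pos.trans_le hB
  have hlogB : 0 ≤ Real.log B := Real.log_nonneg hB
  -- the bookkeeping constants fed to `theorem1_arith`
  set L36 : ℝ := 2 * A' * E / (1 + ε) * Real.log B with hL36def
  have hL36 : 0 ≤ L36 := by rw [hL36def]; positivity
  set AA : ℝ := Real.log C' + Real.log 1728 +
    (1 + ε) * (L36 / 2 + Real.log 6 + Real.log 1729 / 2) with hAAdef
  have hAA0 : 0 ≤ AA := by
    have h1 : 0 ≤ Real.log C' := Real.log_nonneg hC'1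
    have h2 : 0 ≤ Real.log 1728 := Real.log_nonneg (by norm_num)
    have h4 : 0 ≤ Real.log 6 := Real.log_nonneg (by norm_num)
    have h5 : 0 ≤ Real.log 1729 := Real.log_nonneg (by norm_num)
    rw [hAAdef]; positivity
  refine ⟨3 * (1 + ε) / (1 - 5 * ε) * (2 * A' * E / (1 + ε)), 6 * AA / (1 - 5 * ε) + 28,
    by positivity, ?_⟩
  intro D hD h4 K _ _ ι g₂ g₃ hg₂ hg₃ hdisc
  -- notation and basic facts
  have hD3 : D ≤ -3 := by omega
  set d : ℝ := -(D : ℝ) with hddef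
  have hd3 : (3 : ℝ) ≤ d := by
    have : ((D : ℤ) : ℝ) ≤ -3 := by exact_mod_cast hD3
    rw [hddef]; linarith
  have hd0 : 0 < d := by linarith
  have habsD : |(D : ℝ)| = d := by
    rw [hddef, abs_of_neg (by exact_mod_cast hD)]
  set n : ℕ := Module.finrank ℚ K with hndef
  have hn : 0 < n := Module.finrank_pos
  have hn' : (0 : ℝ) < n := by exact_mod_cast hn
  set h : ℕ := classNumber D with hhdef
  have hh : 0 < h := classNumber_pos hD h4
  have hh' : (0 : ℝ) < h := by exact_mod_cast hh
  have hP : principalForm D ∈ reducedForms D := principalForm_mem_reducedForms hD h4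
  have hlogd : 0 ≤ Real.log d := Real.log_nonneg (by linarith)
  have hcoef : 0 ≤ 3 * (1 + ε) / (1 - 5 * ε) * (2 * A' * E / (1 + ε)) := by positivity
  -- every reduced form has `a ≥ 1` and discriminant `D`
  have hQ : ∀ Q ∈ reducedForms D, discr Q = D ∧ 0 < Q.1 := fun Q hQ =>
    let h := (mem_reducedForms_iff hD).1 hQ
    ⟨h.1, h.2.1⟩
  have hsum_le : ∑ Q ∈ reducedForms D, (1 : ℝ) / Q.1 ≤ h := by
    calc ∑ Q ∈ reducedForms D, (1 : ℝ) / Q.1 ≤ ∑ Q ∈ reducedForms D, (1 : ℝ) := by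
          refine Finset.sum_le_sum fun Q hQ' => ?_
          have h1 : (1 : ℝ) ≤ Q.1 := by exact_mod_cast (hQ Q hQ').2
          rw [div_le_one (by linarith)]
          exact h1
      _ = h := by
          rw [Finset.sum_const, nsmul_eq_mul, mul_one, hhdef]
          rfl
  have hsum0 : 0 ≤ ∑ Q ∈ reducedForms D, (1 : ℝ) / Q.1 :=
    Finset.sum_nonneg fun Q hQ' => by
      have h1 : (0 : ℝ) < Q.1 := by exact_mod_cast (hQ Q hQ').2
      positivity
  -- the right-hand side is at least `28 h`
  have hRHS : (h : ℝ) * 28 ≤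
      h * (3 * (1 + ε) / (1 - 5 * ε) * (2 * A' * E / (1 + ε)) * Real.log d +
        (6 * AA / (1 - 5 * ε) + 28)) := by
    refine mul_le_mul_of_nonneg_left ?_ hh'.le
    have : 0 ≤ 6 * AA / (1 - 5 * ε) := by positivity
    nlinarith
  by_cases hsmall : d ≤ 32
  · -- small discriminants: the bound is trivial
    have hsqrt : √d ≤ 6 := by
      rw [Real.sqrt_le_left (by norm_num)]
      linarith
    have hpi : Real.pi ≤ 4 := Real.pi_le_four
    calc Real.pi * √d * ∑ Q ∈ reducedForms D, (1 : ℝ) / Q.1 ≤ 4 * 6 * h := by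
          have := Real.sqrt_nonneg d
          have := Real.pi_pos.le
          gcongr
      _ ≤ h * 28 := by linarith
      _ ≤ _ := hRHS
  -- large discriminants
  push Not at hsmall
  set jP : ℂ := formJ (principalForm D) with hjPdef
  -- `j(τ_P)` is large, in particular `≠ 0, 1728`
  have hjP : Real.pi * √d - 10 ≤ Real.log (max 1 ‖jP‖) := by
    have := pi_mul_sqrt_div_sub_le_log_norm_formJ (hQ _ hP).2 (by rw [(hQ _ hP).1]; exact hD)
    rw [(hQ _ hP).1, principalForm_fst, Int.cast_one, div_one] at this
    simpa [hddef] using this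
  have hjP' : (1728 : ℝ) < ‖jP‖ := norm_gt_of_pi_mul_sqrt_sub_le hsmall hjP
  have hjP0 : jP ≠ 0 := by
    intro h0; rw [h0, norm_zero] at hjP'; linarith
  have hjP1728 : jP - 1728 ≠ 0 := by
    intro h0
    have : jP = 1728 := sub_eq_zero.1 h0
    rw [this] at hjP'
    norm_num at hjP'
  -- the algebraic data in `K`
  set j : K := (g₂ : K) ^ 3 with hjdef
  have hιj : ι j = jP := by rw [hjdef, map_pow, hg₂]
  have hg₃' : ((g₃ : K)) ^ 2 = j - 1728 := by
    apply ι.injective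
    rw [map_pow, hg₃, map_sub, hιj, map_ofNat]
  have hj0 : j ≠ 0 := by
    intro h0; apply hjP0; rw [← hιj, h0, map_zero]
  have hg₂K : (g₂ : K) ≠ 0 := fun h0 => hj0 (by rw [hjdef, h0]; ring)
  have hg₃K : (g₃ : K) ≠ 0 := by
    intro h0
    apply hjP1728
    rw [← hιj, ← map_ofNat ι 1728, ← map_sub, ← hg₃', h0]
    simp
  have hg₂0 : g₂ ≠ 0 := fun h0 => hg₂K (by rw [h0]; rfl)
  have hg₃0 : g₃ ≠ 0 := fun h0 => hg₃K (by rw [h0]; rfl)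
  have hsumK : (1728 : K) + (g₃ : K) ^ 2 = (g₂ : K) ^ 3 := by
    rw [hg₃', ← hjdef]; ring
  -- `O`-weak uniform abc
  have key := hC K (1728 : K) ((g₃ : K) ^ 2) ((g₂ : K) ^ 3) (by norm_num) (pow_ne_zero _ hg₃K)
    (pow_ne_zero _ hg₂K) hsumK
  have hvec : (![(1728 : K), (g₃ : K) ^ 2, (g₂ : K) ^ 3] : Fin 3 → K) =
      ![(1728 : K), j - 1728, j] := by
    rw [hg₃']
  rw [hvec] at key
  -- the quantities `M`, `N`, `N₂`, `N₃`, `dK`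
  set M : ℝ := ∏ w : InfinitePlace K, max 1 (w j) ^ w.mult with hMdef
  set N : ℝ := (radicalNorm (1728 : K) ((g₃ : K) ^ 2) ((g₂ : K) ^ 3) : ℝ) with hNdef
  set N₂ : ℝ := ((Algebra.norm ℤ g₂).natAbs : ℝ) with hN₂def
  set N₃ : ℝ := ((Algebra.norm ℤ g₃).natAbs : ℝ) with hN₃def
  set dK : ℝ := |(NumberField.discr K : ℝ)| with hdKdef
  have hM1 : 1 ≤ M := by
    rw [hMdef]
    exact Finset.prod_induction _ (fun x : ℝ => 1 ≤ x)
      (fun a b ha hb => one_le_mul_of_one_le_of_one_le ha hb) le_rfl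
      fun w _ => one_le_pow₀ (le_max_left _ _)
  have hM0 : 0 < M := one_pos.trans_le hM1
  have hN1 : 1 ≤ N := by rw [hNdef]; exact_mod_cast one_le_radicalNorm _ _ _
  have hN0 : 0 < N := one_pos.trans_le hN1
  have hN₂1 : 1 ≤ N₂ := by
    rw [hN₂def, Nat.one_le_cast, Nat.one_le_iff_ne_zero, Ne, Int.natAbs_eq_zero,
      Algebra.norm_eq_zero_iff]
    exact hg₂0
  have hN₃1 : 1 ≤ N₃ := by
    rw [hN₃def, Nat.one_le_cast, Nat.one_le_iff_ne_zero, Ne, Int.natAbs_eq_zero,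
      Algebra.norm_eq_zero_iff]
    exact hg₃0
  have hN₂0 : 0 < N₂ := one_pos.trans_le hN₂1
  have hN₃0 : 0 < N₃ := one_pos.trans_le hN₃1
  have hdK1 : 1 ≤ dK := by
    rw [hdKdef, ← Int.cast_abs, ← Int.cast_one, Int.cast_le]
    exact Int.one_le_abs (NumberField.discr_ne_zero K)
  have hdK0 : 0 < dK := one_pos.trans_le hdK1
  -- the four inequalities
  have hMH : M ≤ (1728 : ℝ) ^ n * Height.mulHeight ![(1728 : K), j - 1728, j] :=
    prod_max_pow_le_mulHeight j
  have hNle : N ≤ (6 : ℝ) ^ n * N₂ * N₃ := by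
    rw [hNdef, hN₂def, hN₃def]
    exact_mod_cast radicalNorm_le_of_sq_of_cube hg₂0 hg₃0
  have hN₂le : N₂ ^ 3 ≤ M := natAbs_norm_pow_three_le g₂
  have hN₃le : N₃ ^ 2 ≤ (1729 : ℝ) ^ n * M := natAbs_norm_sq_le g₃ hg₃'
  -- abc in multiplicative form: `M ≤ 1728ⁿ C'ⁿ dK^{A'} N^{1+ε}`
  have hCn : C ^ n ≤ C' ^ n := by
    calc C ^ n ≤ |C ^ n| := le_abs_self _
      _ = |C| ^ n := abs_pow C n
      _ ≤ C' ^ n := pow_le_pow_left₀ (abs_nonneg C) (le_max_left _ _) n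
  have hdKA : dK ^ A ≤ dK ^ A' := Real.rpow_le_rpow_of_exponent_le hdK1 (le_max_left _ _)
  have hrpowN : (0 : ℝ) < N ^ (1 + ε) := Real.rpow_pos_of_pos hN0 _
  have hrpowd : (0 : ℝ) < dK ^ A' := Real.rpow_pos_of_pos hdK0 _
  have habc' : M ≤ (1728 : ℝ) ^ n * (C' ^ n * dK ^ A' * N ^ (1 + ε)) := by
    have h1 : Height.mulHeight ![(1728 : K), j - 1728, j] ≤ C' ^ n * dK ^ A' * N ^ (1 + ε) := by
      refine key.le.trans ?_
      have h2 : C ^ n * dK ^ A ≤ C' ^ n * dK ^ A' :=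
        mul_le_mul hCn hdKA (Real.rpow_nonneg hdK0.le _) (pow_nonneg hC'0.le n)
      exact mul_le_mul_of_nonneg_right h2 hrpowN.le
    calc M ≤ (1728 : ℝ) ^ n * Height.mulHeight ![(1728 : K), j - 1728, j] := hMH
      _ ≤ _ := mul_le_mul_of_nonneg_left h1 (by positivity)
  -- take logarithms: first the two facts using `hdisc` and `habc'`, which are then cleared
  set LdK : ℝ := A' / (1 + ε) * Real.log dK with hLdKdef
  set Ld : ℝ := 2 * A' * E / (1 + ε) * Real.log d with hLddef
  have hBd : (0 : ℝ) < B * d := mul_pos hB0 hd0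
  have hlogdK : LdK ≤ n / 2 * (L36 + Ld) := by
    have h1 : Real.log dK ≤ Real.log ((B * |(D : ℝ)|) ^ (E * (n : ℝ))) :=
      Real.log_le_log hdK0 hdisc
    rw [habsD, Real.log_rpow hBd, Real.log_mul hB0.ne' hd0.ne'] at h1
    have h2 := mul_le_mul_of_nonneg_left h1 (show 0 ≤ A' / (1 + ε) by positivity)
    have h3 : (n : ℝ) / 2 * (L36 + Ld) =
        A' / (1 + ε) * (E * (n : ℝ) * (Real.log B + Real.log d)) := by
      rw [hL36def, hLddef]; ring
    rw [h3, hLdKdef]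
    exact h2
  have h1728n : (0 : ℝ) < 1728 ^ n := pow_pos (by norm_num) n
  have hC'n : (0 : ℝ) < C' ^ n := pow_pos hC'0 n
  have hlogabc : Real.log M ≤ n * Real.log 1728 + n * Real.log C' +
      (1 + ε) * (LdK + Real.log N) := by
    have h1 := Real.log_le_log hM0 habc'
    rw [Real.log_mul h1728n.ne' (mul_pos (mul_pos hC'n hrpowd) hrpowN).ne', Real.log_pow,
      Real.log_mul (mul_pos hC'n hrpowd).ne' hrpowN.ne', Real.log_mul hC'n.ne' hrpowd.ne',
      Real.log_pow, Real.log_rpow hdK0, Real.log_rpow hN0] at h1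
    have h2 : (1 + ε) * LdK = A' * Real.log dK := by
      rw [hLdKdef]; field_simp
    linarith only [h1, h2]
  clear key habc' hMH hdisc hrpowN hrpowd hdKA
  have hlogM0 : 0 ≤ Real.log M := Real.log_nonneg hM1
  have hlogN₂ : Real.log N₂ ≤ Real.log M / 3 := by
    have h1 : Real.log (N₂ ^ 3) ≤ Real.log M := Real.log_le_log (pow_pos hN₂0 3) hN₂le
    rw [Real.log_pow] at h1
    push_cast at h1
    linarith only [h1]
  have h1729n : (0 : ℝ) < 1729 ^ n := pow_pos (by norm_num) n
  have hlogN₃ : Real.log N₃ ≤ (n * Real.log 1729 + Real.log M) / 2 := by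
    have h1 : Real.log (N₃ ^ 2) ≤ Real.log ((1729 : ℝ) ^ n * M) :=
      Real.log_le_log (pow_pos hN₃0 2) hN₃le
    rw [Real.log_pow, Real.log_mul h1729n.ne' hM0.ne', Real.log_pow] at h1
    push_cast at h1
    linarith only [h1]
  have h6n : (0 : ℝ) < 6 ^ n := pow_pos (by norm_num) n
  have hlogN : Real.log N ≤ n * Real.log 6 + Real.log N₂ + Real.log N₃ := by
    have h1 : Real.log N ≤ Real.log ((6 : ℝ) ^ n * N₂ * N₃) := Real.log_le_log hN0 hNle
    rw [Real.log_mul (mul_pos h6n hN₂0).ne' hN₃0.ne', Real.log_mul h6n.ne' hN₂0.ne',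
      Real.log_pow] at h1
    linarith only [h1]
  -- conjugates: `h · log M = n · ∑_Q log max(1, |j(τ_Q)|)`
  have hlogMsum : Real.log M = ∑ φ : K →+* ℂ, Real.log (max 1 ‖φ j‖) := by
    rw [hMdef, prod_infinitePlace_pow_mult_eq_prod_embeddings (fun t => max 1 t) j,
      Real.log_prod]
    intro φ _
    exact (one_pos.trans_le (le_max_left _ _)).ne'
  have hconj := classNumber_mul_sum_embeddings_eq ι hD h4 hιj (fun z => Real.log (max 1 ‖z‖))
  rw [← hlogMsum] at hconj
  -- the lower bound for the singular moduli
  have hlow : ∑ Q ∈ reducedForms D, (Real.pi * √d / Q.1 - 10) ≤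
      ∑ Q ∈ reducedForms D, Real.log (max 1 ‖formJ Q‖) := by
    refine Finset.sum_le_sum fun Q hQ' => ?_
    have h1 := pi_mul_sqrt_div_sub_le_log_norm_formJ (hQ Q hQ').2
      (by rw [(hQ Q hQ').1]; exact hD)
    rw [(hQ Q hQ').1] at h1
    simpa [hddef] using h1
  have hlow' : ∑ Q ∈ reducedForms D, (Real.pi * √d / Q.1 - 10) =
      Real.pi * √d * ∑ Q ∈ reducedForms D, (1 : ℝ) / Q.1 - 10 * h := by
    rw [Finset.sum_sub_distrib, Finset.mul_sum, Finset.sum_const, nsmul_eq_mul, hhdef]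
    have hcard : ((reducedForms D).card : ℝ) = (classNumber D : ℝ) := rfl
    rw [hcard, mul_comm _ (10 : ℝ)]
    simp only [mul_one_div]
  -- final assembly
  have hfin : (n : ℝ) * (Real.pi * √d * ∑ Q ∈ reducedForms D, (1 : ℝ) / Q.1 - 10 * h) ≤
      h * Real.log M := by
    calc (n : ℝ) * (Real.pi * √d * ∑ Q ∈ reducedForms D, (1 : ℝ) / Q.1 - 10 * h)
        = n * ∑ Q ∈ reducedForms D, (Real.pi * √d / Q.1 - 10) := by rw [hlow']
      _ ≤ n * ∑ Q ∈ reducedForms D, Real.log (max 1 ‖formJ Q‖) :=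
          mul_le_mul_of_nonneg_left hlow hn'.le
      _ = h * Real.log M := hconj.symm
  have hmain := theorem1_arith hε hε5 hn' hh'.le hAA0 hAAdef hlogabc hlogdK hlogN hlogN₂ hlogN₃ hfin
  have e : 3 * (1 + ε) / (1 - 5 * ε) * Ld =
      3 * (1 + ε) / (1 - 5 * ε) * (2 * A' * E / (1 + ε)) * Real.log d := by
    rw [hLddef]; ring
  rw [e] at hmain
  exact hmain

end HeightArgument

/-! ### A class-number bound with some positive constant (Theorem 1 with `π/3` replaced by `c > 0`) -/

section Join

/-- **Granville–Stark's Theorem 1 with an unspecified constant, under `O`-weak abc, from the CM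
datum.** Assume the `O`-weak uniform abc conjecture, and assume the complex-multiplication datum in
polynomial form: constants `B ≥ 1`, `E ≥ 0`, `d₁` such that for every modulus `d ≥ d₁` carrying an
odd real primitive character (equivalently: `−d` a negative fundamental discriminant) there are a
number field `K` with a complex embedding `ι` and algebraic integers `g₂, g₃ ∈ 𝓞 K` with
`ι(g₂)³ = j(τ_{−d}) = ι(g₃)² + 1728` and `|D_K| ≤ (B d)^{E[K:ℚ]}` ([Tafula2021, Lemma 5.4] /
[GranvilleStark2000, Lemma 1] give it with `K = ℚ(√−d, γ₂, γ₃)`, `B = 36`, `E = 1/2`). Then there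
are `c > 0` and `d₀` with `c · (√d/log d) · ∑_{(a,b,c) reduced} 1/a ≤ h(−d)` for all such `d ≥ d₀` —
Granville–Stark's (2) with `π/3 + o(1)` replaced by a positive constant ("analogous, though slightly
weaker, results" [GranvilleStark2000, §1]); in Táfula's wording `limsup ht(j(τ_D))/log|D| < ∞`
[Tafula2021, §5.2, proof of Theorem 1.3]. Proof: `pi_mul_sqrt_mul_sum_inv_le_of_oWeakABC` and
`C₀ ≤ log d` for `d ≥ exp C₀`, with `c = π/(κ + 1)`. [cite: Tafula2021, §5.2 (proof of Theorem 1.3)] -/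
theorem oWeak_classNumber_bound_of_cmData
    (habc : ∀ ε : ℝ, 0 < ε → ∃ A C : ℝ, ∀ (K : Type) [Field K] [NumberField K] (a b c : K),
      a ≠ 0 → b ≠ 0 → c ≠ 0 → a + b = c →
        Height.mulHeight ![a, b, c] <
          C ^ Module.finrank ℚ K * (|NumberField.discr K| : ℝ) ^ A *
            (radicalNorm a b c : ℝ) ^ (1 + ε))
    (hdata : ∃ B E : ℝ, 1 ≤ B ∧ 0 ≤ E ∧ ∃ d₁ : ℕ, ∀ (d : ℕ) [NeZero d], d₁ ≤ d →
      (∃ χ : DirichletCharacter ℂ d, χ.IsQuadratic ∧ χ.IsPrimitive ∧ χ.Odd) →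
        ∃ (K : Type) (_ : Field K) (_ : NumberField K) (ι : K →+* ℂ) (g₂ g₃ : 𝓞 K),
          ι (g₂ : K) ^ 3 = formJ (principalForm (-(d : ℤ))) ∧
          ι (g₃ : K) ^ 2 = formJ (principalForm (-(d : ℤ))) - 1728 ∧
          |(NumberField.discr K : ℝ)| ≤ (B * (d : ℝ)) ^ (E * (Module.finrank ℚ K : ℝ))) :
    ∃ c : ℝ, 0 < c ∧ ∃ d₀ : ℕ, ∀ (d : ℕ) [NeZero d], d₀ ≤ d →
      (∃ χ : DirichletCharacter ℂ d, χ.IsQuadratic ∧ χ.IsPrimitive ∧ χ.Odd) →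
        c * (Real.sqrt d / Real.log d) *
            ∑ Q ∈ reducedForms (-(d : ℤ)), (1 : ℝ) / (Q.1 : ℝ) ≤ classNumber (-(d : ℤ)) := by
  obtain ⟨B, E, hB, hE, d₁, hdata⟩ := hdata
  obtain ⟨κ, C₀, hκ, hmain⟩ := pi_mul_sqrt_mul_sum_inv_le_of_oWeakABC habc hB hE
  refine ⟨Real.pi / (κ + 1), by positivity, max d₁ (⌈Real.exp (max C₀ 0)⌉₊ + 3), ?_⟩
  intro d _ hd hχ
  have hd₁ : d₁ ≤ d := le_of_max_le_left hd
  have hd3 : 3 ≤ d := by have := le_of_max_le_right hd; omega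
  have hd3' : (3 : ℝ) ≤ d := by exact_mod_cast hd3
  have hd0' : (0 : ℝ) < d := by linarith
  have hlogd : 0 < Real.log d := Real.log_pos (by linarith)
  -- `C₀ ≤ log d`
  have hC : C₀ ≤ Real.log d := by
    have h1 : (⌈Real.exp (max C₀ 0)⌉₊ : ℝ) ≤ d := by
      exact_mod_cast (Nat.le_add_right _ 3).trans (le_of_max_le_right hd)
    have h2 : Real.exp (max C₀ 0) ≤ d := (Nat.le_ceil _).trans h1
    have h3 : max C₀ 0 ≤ Real.log d := by
      rw [← Real.log_exp (max C₀ 0)]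
      exact Real.log_le_log (Real.exp_pos _) h2
    exact (le_max_left C₀ 0).trans h3
  -- the data and the height inequality
  obtain ⟨χ, hquad, hprim, hodd⟩ := hχ
  have h4 := neg_emod_four_of_odd hprim hquad hodd
  have hD : (-(d : ℤ)) < 0 := by omega
  obtain ⟨K, _, _, ι, g₂, g₃, hg₂, hg₃, hdisc⟩ := hdata d hd₁ ⟨χ, hquad, hprim, hodd⟩
  have habs : |(((-(d : ℤ)) : ℤ) : ℝ)| = (d : ℝ) := by
    push_cast
    rw [abs_neg, abs_of_nonneg (Nat.cast_nonneg _)]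
  have hneg : -(((-(d : ℤ)) : ℤ) : ℝ) = (d : ℝ) := by push_cast; ring
  have hm := hmain (-(d : ℤ)) hD h4 K ι g₂ g₃ hg₂ hg₃ (by rw [habs]; exact hdisc)
  rw [hneg] at hm
  -- bookkeeping: `π √d S ≤ h (κ log d + C₀) ≤ h (κ + 1) log d`
  set S : ℝ := ∑ Q ∈ reducedForms (-(d : ℤ)), (1 : ℝ) / (Q.1 : ℝ) with hSdef
  set h : ℝ := (classNumber (-(d : ℤ)) : ℝ) with hhdef
  have hh : 0 ≤ h := Nat.cast_nonneg _
  have hS : 0 ≤ S := Finset.sum_nonneg fun Q hQ => by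
    have h1 : (0 : ℝ) < Q.1 := by exact_mod_cast ((mem_reducedForms_iff hD).1 hQ).2.1
    positivity
  have h1 : Real.pi * Real.sqrt d * S ≤ h * ((κ + 1) * Real.log d) := by
    calc Real.pi * Real.sqrt d * S ≤ h * (κ * Real.log d + C₀) := hm
      _ ≤ h * ((κ + 1) * Real.log d) := by
          refine mul_le_mul_of_nonneg_left ?_ hh
          linarith
  have hκ1 : 0 < κ + 1 := by linarith
  have e : Real.pi / (κ + 1) * (Real.sqrt d / Real.log d) * S =
      Real.pi * Real.sqrt d * S / ((κ + 1) * Real.log d) := by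
    field_simp
  rw [e, div_le_iff₀ (by positivity)]
  linarith

/-! ### `L'/L(1, χ) ≪ log d` from a class-number bound with any constant and the upper half of (11) -/

/-- **From the two class-number inequalities to `L'/L(1, χ) ≪ log d`, any constant.** Let `d ≥ 3`,
`h > 0` the number of reduced forms of discriminant `−d`, `S = ∑ 1/a`, `E = ∑ log(√d/a)` over them,
`L ∈ ℝ` and `c > 0`. If `c (√d/log d) S ≤ h` and `h (L + ½ log d) ≤ (π/6) √d S + A₀ E` (the upper
half of [GranvilleStark2000, eq. (11)]), then `L ≤ (π/(6c) + |A₀|) log d`, because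
`(π/6)√d S ≤ (π/(6c)) h log d` and `0 ≤ E ≤ ½ h log d` (`1 ≤ a ≤ √(d/3)`). The tree's
`logDeriv_le_of_classNumber_bounds` is the case `c = π/6`; Granville–Stark note that any positive
constant in Theorem 1 still yields Mahler's bound [GranvilleStark2000, §1 and §3.1 Remark 1].
[cite: GranvilleStark2000, §3.1 Remark 1 and §3.2 eq. (11)] -/
theorem logDeriv_le_of_classNumber_bounds_const {d : ℕ} (hd : 3 ≤ d) {L A₀ c : ℝ} (hc : 0 < c)
    (hh : 0 < classNumber (-(d : ℤ)))
    (hlow : c * (Real.sqrt d / Real.log d) *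
        ∑ Q ∈ reducedForms (-(d : ℤ)), (1 : ℝ) / (Q.1 : ℝ) ≤ classNumber (-(d : ℤ)))
    (hup : (classNumber (-(d : ℤ)) : ℝ) * (L + Real.log d / 2) ≤
        Real.pi / 6 * Real.sqrt d * ∑ Q ∈ reducedForms (-(d : ℤ)), (1 : ℝ) / (Q.1 : ℝ) +
          A₀ * ∑ Q ∈ reducedForms (-(d : ℤ)), Real.log (Real.sqrt d / (Q.1 : ℝ))) :
    L ≤ (Real.pi / 6 / c + |A₀|) * Real.log d := by
  have hd0 : 0 < d := by omega
  have hd3 : (3 : ℝ) ≤ d := by exact_mod_cast hd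
  have hlog : 0 < Real.log d := Real.log_pos (by linarith)
  set S : ℝ := ∑ Q ∈ reducedForms (-(d : ℤ)), (1 : ℝ) / (Q.1 : ℝ) with hSdef
  set E : ℝ := ∑ Q ∈ reducedForms (-(d : ℤ)), Real.log (Real.sqrt d / (Q.1 : ℝ)) with hEdef
  set h : ℝ := (classNumber (-(d : ℤ)) : ℝ) with hhdef
  have hhpos : 0 < h := by rw [hhdef]; exact_mod_cast hh
  -- `0 ≤ E ≤ h log d / 2`
  have hE0 : 0 ≤ E :=
    Finset.sum_nonneg fun Q hQ ↦ (log_sqrt_div_mem_of_mem_reducedForms hd0 hQ).1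
  have hE : E ≤ h * (Real.log d / 2) := by
    calc E ≤ ∑ Q ∈ reducedForms (-(d : ℤ)), Real.log d / 2 :=
          Finset.sum_le_sum fun Q hQ ↦ (log_sqrt_div_mem_of_mem_reducedForms hd0 hQ).2
      _ = h * (Real.log d / 2) := by rw [Finset.sum_const, nsmul_eq_mul, hhdef]; rfl
  -- `c √d S ≤ h log d`, hence `(π/6) √d S ≤ (π/6/c) h log d`
  have hT : c * Real.sqrt d * S ≤ h * Real.log d := by
    have : c * (Real.sqrt d / Real.log d) * S = (c * Real.sqrt d * S) / Real.log d := by ring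
    rw [this, div_le_iff₀ hlog] at hlow
    exact hlow
  have hT' : Real.pi / 6 * Real.sqrt d * S ≤ Real.pi / 6 / c * (h * Real.log d) := by
    have e : Real.pi / 6 * Real.sqrt d * S = Real.pi / 6 / c * (c * Real.sqrt d * S) := by
      field_simp
    rw [e]
    exact mul_le_mul_of_nonneg_left hT (by positivity)
  -- `A₀ E ≤ |A₀| h log d / 2`
  have hA : A₀ * E ≤ |A₀| * (h * (Real.log d / 2)) :=
    (mul_le_mul_of_nonneg_right (le_abs_self A₀) hE0).trans
      (mul_le_mul_of_nonneg_left hE (abs_nonneg _))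
  -- combine and divide by `h`
  have hcomb : h * (L + Real.log d / 2) ≤
      h * (Real.pi / 6 / c * Real.log d + |A₀| * (Real.log d / 2)) := by
    calc h * (L + Real.log d / 2) ≤ Real.pi / 6 * Real.sqrt d * S + A₀ * E := hup
      _ ≤ Real.pi / 6 / c * (h * Real.log d) + |A₀| * (h * (Real.log d / 2)) := add_le_add hT' hA
      _ = h * (Real.pi / 6 / c * Real.log d + |A₀| * (Real.log d / 2)) := by ring
  have hdiv : L + Real.log d / 2 ≤ Real.pi / 6 / c * Real.log d + |A₀| * (Real.log d / 2) :=
    le_of_mul_le_mul_left hcomb hhpos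
  have habs : 0 ≤ |A₀| := abs_nonneg _
  nlinarith

/-! ### The barrier entry from the CM datum and eq. (11) -/

/-- **`OWeakUniformABCImpliesNoSiegelZeros` from the CM datum and eq. (11)** — Táfula's
Theorem 1.2 (`O`-weak case) / Granville–Stark's Theorem 2 "with `Δ_K` replaced by `Δ_K^A`",
proved from two displayed statements of the sources, neither of which mentions abc or zeros:

* `hdata` — the complex-multiplication datum in polynomial form: `B ≥ 1`, `E ≥ 0`, `d₁` such that
  for every `d ≥ d₁` carrying an odd real primitive character mod `d` there are a number field
  `K ∋ g₂, g₃` (algebraic integers) with a complex embedding `ι`, `ι(g₂)³ = j(τ_{−d}) = ι(g₃)² + 1728`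
  and `|D_K| ≤ (B d)^{E[K:ℚ]}` — [Tafula2021, Lemma 5.4] = [GranvilleStark2000, Lemma 1]
  (`𝓛 = ℚ(γ₂(τ_D), γ₃(τ_D))`, `rd_𝓛 ≤ 6√|D|`, i.e. `B = 36`, `E = 1/2`, all `d`), where "it would
  be enough to have `rd_𝓛 ≪_ε |D|^{1/2+ε}`" [Tafula2021, after Lemma 5.4] — and for the `O`-weak
  entry any polynomial bound;
* `eq11` — [GranvilleStark2000, §3.2 eq. (11)] (Selberg–Chowla + Dirichlet's class number
  formula): `|h(−d)(L'/L(1, χ_d) + ½ log d) − (π/6)√d ∑ 1/a| ≤ A₀ ∑_{(a,b,c) reduced} log(√d/a)`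
  for all large `d` — verbatim the hypothesis `eq11` of the tree's
  `granville_stark_noSiegelZeros_of_thm1_of_eq11`.

Proof ([Tafula2021, §5.2]; [GranvilleStark2000, §1, §3.1 Remark 1]): under the `O`-weak hypothesis
`oWeak_classNumber_bound_of_cmData` gives `c (√d/log d) ∑ 1/a ≤ h(−d)` for large `d`; with the
upper half of (11), `logDeriv_le_of_classNumber_bounds_const` gives
`Re L'/L(1, χ) ≤ (π/(6c) + |A₀|) log d`; and the Mahler–Granville–Stark criterion
`noSiegelZerosOddQuadratic_of_eventually_logDeriv_le` yields `NoSiegelZerosOddQuadratic`.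
[cite: Tafula2021, Theorem 1.2 (proof, §5.2)] -/
theorem OWeakUniformABCImpliesNoSiegelZeros.of_cmData_of_eq11
    (hdata : ∃ B E : ℝ, 1 ≤ B ∧ 0 ≤ E ∧ ∃ d₁ : ℕ, ∀ (d : ℕ) [NeZero d], d₁ ≤ d →
      (∃ χ : DirichletCharacter ℂ d, χ.IsQuadratic ∧ χ.IsPrimitive ∧ χ.Odd) →
        ∃ (K : Type) (_ : Field K) (_ : NumberField K) (ι : K →+* ℂ) (g₂ g₃ : 𝓞 K),
          ι (g₂ : K) ^ 3 = formJ (principalForm (-(d : ℤ))) ∧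
          ι (g₃ : K) ^ 2 = formJ (principalForm (-(d : ℤ))) - 1728 ∧
          |(NumberField.discr K : ℝ)| ≤ (B * (d : ℝ)) ^ (E * (Module.finrank ℚ K : ℝ)))
    (eq11 : ∃ A₀ : ℝ, ∃ d₀ : ℕ, ∀ (d : ℕ) [NeZero d], d₀ ≤ d → ∀ χ : DirichletCharacter ℂ d,
      χ.IsQuadratic → χ.IsPrimitive → χ.Odd →
        |(classNumber (-(d : ℤ)) : ℝ) * ((deriv χ.LFunction 1 / χ.LFunction 1).re + Real.log d / 2) -
            Real.pi / 6 * Real.sqrt d * ∑ Q ∈ reducedForms (-(d : ℤ)), (1 : ℝ) / (Q.1 : ℝ)| ≤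
          A₀ * ∑ Q ∈ reducedForms (-(d : ℤ)), Real.log (Real.sqrt d / (Q.1 : ℝ))) :
    OWeakUniformABCImpliesNoSiegelZeros := by
  intro habc
  obtain ⟨A₀, d₂, h11⟩ := eq11
  obtain ⟨c, hc, d₁, h1⟩ := oWeak_classNumber_bound_of_cmData habc hdata
  refine noSiegelZerosOddQuadratic_of_eventually_logDeriv_le
    ⟨Real.pi / 6 / c + |A₀|, max d₁ d₂, ?_⟩
  intro d _ hd0 hd3 χ hquad hprim hodd
  -- `h(−d) ≥ 1`
  have h4 := neg_emod_four_of_odd hprim hquad hodd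
  have hh : 0 < classNumber (-(d : ℤ)) := classNumber_pos (by omega) h4
  -- the class-number bound with constant `c`
  have hlow := h1 d (le_of_max_le_left hd0) ⟨χ, hquad, hprim, hodd⟩
  -- the upper half of (11)
  have h11d := h11 d (le_of_max_le_right hd0) χ hquad hprim hodd
  have hup := (le_abs_self _).trans h11d
  exact logDeriv_le_of_classNumber_bounds_const hd3 hc hh hlow (by linarith)

/-- **`OWeakUniformABCImpliesNoSiegelZeros` from the data of Lemma 1 and eq. (11)** — from the two
hypotheses, VERBATIM, of the tree's
`Literature.NumberTheory.DiophantineGeometry.granville_stark_noSiegelZeros_of_lemma1Data_of_eq11`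
(`hdata`: for every `d` carrying an odd real primitive character a number field `K ∋ γ₂, γ₃` with
`|D_K| ≤ (36 d)^{[K:ℚ]/2}` [GranvilleStark2000, Lemma 1] = [Tafula2021, Lemma 5.4]; `eq11`:
[GranvilleStark2000, §3.2 eq. (11)]). Hence one proof of these two statements discharges
`granville_stark_noSiegelZeros`, `UniformABCImpliesNoSiegelZeros` and
`OWeakUniformABCImpliesNoSiegelZeros` at once (the last implies the other two,
`UniformABCImpliesNoSiegelZeros.of_oWeak`); the `UniformABCImpliesNoSiegelZeros`-valued form of the
present statement is that tree theorem itself (`UniformABCImpliesNoSiegelZeros` is an `abbrev` for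
`granville_stark_noSiegelZeros`), so no separate `UniformABCImpliesNoSiegelZeros.of_lemma1Data_of_eq11`
is kept (dedup-00601/00628). [cite: Tafula2021, Theorem 1.2 with Lemma 5.4] -/
theorem OWeakUniformABCImpliesNoSiegelZeros.of_lemma1Data_of_eq11
    (hdata : ∀ (d : ℕ) [NeZero d],
      (∃ χ : DirichletCharacter ℂ d, χ.IsQuadratic ∧ χ.IsPrimitive ∧ χ.Odd) →
        ∃ (K : Type) (_ : Field K) (_ : NumberField K) (ι : K →+* ℂ) (g₂ g₃ : 𝓞 K),
          ι (g₂ : K) ^ 3 = formJ (principalForm (-(d : ℤ))) ∧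
          ι (g₃ : K) ^ 2 = formJ (principalForm (-(d : ℤ))) - 1728 ∧
          |(NumberField.discr K : ℝ)| ≤ (36 * (d : ℝ)) ^ ((Module.finrank ℚ K : ℝ) / 2))
    (eq11 : ∃ A₀ : ℝ, ∃ d₀ : ℕ, ∀ (d : ℕ) [NeZero d], d₀ ≤ d → ∀ χ : DirichletCharacter ℂ d,
      χ.IsQuadratic → χ.IsPrimitive → χ.Odd →
        |(classNumber (-(d : ℤ)) : ℝ) * ((deriv χ.LFunction 1 / χ.LFunction 1).re + Real.log d / 2) -
            Real.pi / 6 * Real.sqrt d * ∑ Q ∈ reducedForms (-(d : ℤ)), (1 : ℝ) / (Q.1 : ℝ)| ≤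
          A₀ * ∑ Q ∈ reducedForms (-(d : ℤ)), Real.log (Real.sqrt d / (Q.1 : ℝ))) :
    OWeakUniformABCImpliesNoSiegelZeros := by
  refine OWeakUniformABCImpliesNoSiegelZeros.of_cmData_of_eq11
    ⟨36, 1 / 2, by norm_num, by norm_num, 0, fun d _ _ hχ => ?_⟩ eq11
  obtain ⟨K, iF, iN, ι, g₂, g₃, hg₂, hg₃, hdisc⟩ := hdata d hχ
  have e : (1 / 2 : ℝ) * (Module.finrank ℚ K : ℝ) = (Module.finrank ℚ K : ℝ) / 2 := by ring
  exact ⟨K, iF, iN, ι, g₂, g₃, hg₂, hg₃, by rwa [e]⟩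

end Join

/-! ### Session 2 (2026-08-15): eq. (11) is proved — the entry from the CM datum alone, and from
the Hilbert-class-field data it now shares with `granville_stark` / `granville_stark_noSiegelZeros`

Granville–Stark's eq. (11) has meanwhile been PROVED in the tree
(`Literature.NumberTheory.DiophantineGeometry.granvilleStark_eq11`,
`AbcWave0GranvilleStarkEq11Proofs.lean`: Kronecker's limit formula class by class and Dirichlet's
class number formula), with exactly the statement of the hypothesis `eq11` above.  Feeding it in,
the barrier entry depends on ONE remaining input, the complex-multiplication datum, which we state
below in each of the successively weaker forms under which the tree has reduced Granville–Stark's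
Lemma 1 for the sibling facts `granville_stark` (Theorem 1) and `granville_stark_noSiegelZeros`
(Theorem 2) — so that a single proof of any of them discharges all four declarations
(`granville_stark`, `granville_stark_noSiegelZeros`, `UniformABCImpliesNoSiegelZeros`,
`OWeakUniformABCImpliesNoSiegelZeros`):

* `OWeakUniformABCImpliesNoSiegelZeros.of_cmData` — the polynomial datum `|D_K| ≤ (Bd)^{E[K:ℚ]}`
  of `of_cmData_of_eq11`, nothing else;
* `OWeakUniformABCImpliesNoSiegelZeros.of_discrBoundPoly` — the same over imaginary quadratic FIELDS
  `K` (`[K:ℚ] = 2`, no real place, `|d_K|` large), with `u, v ∈ F` NOT assumed integral,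
  `σ₀(u³) = j(τ_{d_K})`, `v² = u³ − 1728`, `|D_F| ≤ (B|d_K|^E)^{[F:ℚ]}` — the shape of
  `granville_stark_of_discrBound` with `√|d_K|` relaxed to any power;
* `OWeakUniformABCImpliesNoSiegelZeros.of_cmInput` — VERBATIM the hypothesis `H` of
  `granville_stark_of_cmInput` / `granville_stark_noSiegelZeros_of_cmInput` (`|D_F| ≤ (6√|d_K|)^{[F:ℚ]}`,
  [GranvilleStark2000, Lemma 1]);
* `OWeakUniformABCImpliesNoSiegelZeros.of_hilbert_cubeSquare_poly` — a number field `L` with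
  `j₀ ∈ 𝓞_L` over `j(τ_{d_K})`, `(j₀) = 𝔞³`, `(j₀ − 1728) = 𝔟²` AS IDEALS and
  `|D_L| ≤ (B|d_K|^E)^{[L:ℚ]}`: the Kummer layer `L(∛j₀, √(j₀ − 1728))` is the tree's proved
  `exists_kummer_tower` (factor `6`);
* `OWeakUniformABCImpliesNoSiegelZeros.of_unramified_cubeSquare` — VERBATIM the hypothesis of
  `granville_stark_of_unramified_cubeSquare`: `L ⊇ K` unramified at every maximal ideal of `𝓞_L`
  (as the Hilbert class field `K(j(τ_D))` is, [Cox2013, Thm. 11.1]) carrying such `j₀, 𝔞, 𝔟`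
  (the ideal-theoretic content of Weber's `γ₂ = ∛j ∈ K(j)` for `3 ∤ D` and of `γ₃`,
  [Cox2013, Thm. 12.2]); `|d_L| = |d_K|^{[L:K]}` by `natAbs_discr_eq_pow_of_forall_isUnramifiedAt`.

What remains for `OWeakUniformABCImpliesNoSiegelZeros_holds` is therefore exactly the pair of
classical theorems of complex multiplication (U) `K(j(τ_D))/K` is unramified, (C) `(j(τ_D)) = 𝔞³`,
`(j(τ_D) − 1728) = 𝔟²` in `K(j(τ_D))` — not restated here as named facts (D-0026). -/

section CMDatumAlone

open NumberField
open _root_.Literature.NumberTheory.NumberFields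
open _root_.Literature.NumberTheory.QuadraticFields.Quadratic (exists_quadraticField_of_odd_primitive)

/-- **`OWeakUniformABCImpliesNoSiegelZeros` from the polynomial CM datum alone** (Táfula's
Theorem 1.2, `O`-weak case, given Lemma 5.4 in polynomial form): for `B ≥ 1`, `E ≥ 0`, `d₁` such that
every `d ≥ d₁` carrying an odd real primitive character has a number field `K ∋ g₂, g₃` (algebraic
integers), `ι(g₂)³ = j(τ_{−d}) = ι(g₃)² + 1728`, `|D_K| ≤ (Bd)^{E[K:ℚ]}`, the `O`-weak uniform abc
conjecture excludes Siegel zeros of odd real characters.  This is `of_cmData_of_eq11` with its second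
hypothesis discharged by the tree's theorem `granvilleStark_eq11` ([GranvilleStark2000, §3.2 (11)]).
[cite: Tafula2021, Theorem 1.2 (proof, §5.2) with Lemma 5.4] -/
theorem OWeakUniformABCImpliesNoSiegelZeros.of_cmData
    (hdata : ∃ B E : ℝ, 1 ≤ B ∧ 0 ≤ E ∧ ∃ d₁ : ℕ, ∀ (d : ℕ) [NeZero d], d₁ ≤ d →
      (∃ χ : DirichletCharacter ℂ d, χ.IsQuadratic ∧ χ.IsPrimitive ∧ χ.Odd) →
        ∃ (K : Type) (_ : Field K) (_ : NumberField K) (ι : K →+* ℂ) (g₂ g₃ : 𝓞 K),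
          ι (g₂ : K) ^ 3 = formJ (principalForm (-(d : ℤ))) ∧
          ι (g₃ : K) ^ 2 = formJ (principalForm (-(d : ℤ))) - 1728 ∧
          |(NumberField.discr K : ℝ)| ≤ (B * (d : ℝ)) ^ (E * (Module.finrank ℚ K : ℝ))) :
    OWeakUniformABCImpliesNoSiegelZeros :=
  OWeakUniformABCImpliesNoSiegelZeros.of_cmData_of_eq11 hdata granvilleStark_eq11

/-- **`OWeakUniformABCImpliesNoSiegelZeros` from a polynomial discriminant bound over imaginary
quadratic fields.**  Hypothesis: constants `B, E, d₁` such that for every imaginary quadratic `K`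
(`[K:ℚ] = 2`, no real place) with `|d_K| ≥ d₁` there are a number field `F`, an embedding
`σ₀ : F → ℂ` and `u, v ∈ F` (not assumed integral) with `σ₀(u³) = j(τ_{d_K})` (the singular modulus of
the principal form of discriminant `d_K`), `v² = u³ − 1728` and `|D_F| ≤ (B|d_K|^E)^{[F:ℚ]}` — the
hypothesis of the tree's `granville_stark_of_discrBound` with `√|d_K|` relaxed to an arbitrary power
(Granville–Stark: "replace `Δ_K` by `Δ_K^A`"; Táfula: "it would be enough to have
`rd_𝓛 ≪_ε |D|^{1/2+ε}`", and for the `O`-weak entry any exponent).  Proof: the modulus `d` of an odd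
real primitive character is `|d_K|` for the quadratic field `K` with `d_K = −d`
(`exists_quadraticField_of_odd_primitive`); `u, v` are algebraic integers
(`isIntegral_int_formJ_principalForm`, `isIntegral_int_of_map_pow_eq`); and
`(B d^E)^n ≤ (max(|B|,1)·d)^{max(E,1)·n}`, so `of_cmData` applies.
[cite: Tafula2021, Lemma 5.4 and the remark after it] [cite: GranvilleStark2000, §1 and §2 Lemma 1] -/
theorem OWeakUniformABCImpliesNoSiegelZeros.of_discrBoundPoly
    (H : ∃ B E d₁ : ℝ, ∀ (K : Type) [Field K] [NumberField K],
      Module.finrank ℚ K = 2 → NumberField.InfinitePlace.nrRealPlaces K = 0 →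
      d₁ ≤ |(NumberField.discr K : ℝ)| →
        ∃ (F : Type) (_ : Field F) (_ : NumberField F) (σ₀ : F →+* ℂ) (u v : F),
          σ₀ (u ^ 3) = formJ (principalForm (NumberField.discr K)) ∧
          v ^ 2 = u ^ 3 - 1728 ∧
          |(NumberField.discr F : ℝ)| ≤
            (B * |(NumberField.discr K : ℝ)| ^ E) ^ Module.finrank ℚ F) :
    OWeakUniformABCImpliesNoSiegelZeros := by
  obtain ⟨B, E, d₁, H⟩ := H
  refine OWeakUniformABCImpliesNoSiegelZeros.of_cmData
    ⟨max |B| 1, max E 1, le_max_right _ _, zero_le_one.trans (le_max_right _ _), ⌈d₁⌉₊, ?_⟩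
  intro d _ hd hχ
  obtain ⟨χ, hquad, hprim, hodd⟩ := hχ
  -- the imaginary quadratic field with `d_K = -d`
  obtain ⟨K, _, _, h2, hdisc⟩ := exists_quadraticField_of_odd_primitive hprim hquad hodd
  have hd0 : 0 < d := Nat.pos_of_ne_zero (NeZero.ne d)
  have hneg : NumberField.discr K < 0 := by rw [hdisc]; omega
  have hK : IsImaginaryQuadratic K := isImaginaryQuadratic_iff_discr_neg.2 ⟨h2, hneg⟩
  have h0 : NumberField.InfinitePlace.nrRealPlaces K = 0 := hK.nrRealPlaces_eq_zero
  have habsK : |(NumberField.discr K : ℝ)| = d := by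
    rw [hdisc]; push_cast; rw [abs_neg, Nat.abs_cast]
  have hd₁ : d₁ ≤ |(NumberField.discr K : ℝ)| := by
    rw [habsK]; exact (Nat.le_ceil d₁).trans (by exact_mod_cast hd)
  obtain ⟨F, instF, instNF, σ₀, u, v, hu, hv, hdiscF⟩ := H K h2 h0 hd₁
  -- `u, v` are algebraic integers
  have hj := isIntegral_int_formJ_principalForm K hK
  have hu' : IsIntegral ℤ u :=
    isIntegral_int_of_map_pow_eq σ₀ three_ne_zero hj (by rw [← map_pow, hu])
  have hv' : IsIntegral ℤ v := by
    refine isIntegral_int_of_map_pow_eq σ₀ two_ne_zero (hj.sub isIntegral_int_ofNat_1728) ?_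
    rw [← map_pow, hv, map_sub, hu, map_ofNat]
  refine ⟨F, instF, instNF, σ₀, ⟨u, hu'⟩, ⟨v, hv'⟩, ?_, ?_, ?_⟩
  · show σ₀ u ^ 3 = _
    rw [← map_pow, hu, hdisc]
  · show σ₀ v ^ 2 = _
    rw [← map_pow, hv, map_sub, hu, map_ofNat, hdisc]
  · -- `|D_F| ≤ (B d^E)^n ≤ (B' d^{E'})^n ≤ (B' d)^{E' n}`, `B' = max |B| 1`, `E' = max E 1`
    rw [habsK] at hdiscF
    have hd1 : (1 : ℝ) ≤ d := by exact_mod_cast hd0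
    have hdE : (0 : ℝ) ≤ (d : ℝ) ^ E := Real.rpow_nonneg (by positivity) E
    have hB' : (1 : ℝ) ≤ max |B| 1 := le_max_right _ _
    have hE' : (1 : ℝ) ≤ max E 1 := le_max_right _ _
    have h1 : (B * (d : ℝ) ^ E) ^ Module.finrank ℚ F ≤
        (max |B| 1 * (d : ℝ) ^ max E 1) ^ Module.finrank ℚ F := by
      calc (B * (d : ℝ) ^ E) ^ Module.finrank ℚ F
          ≤ |(B * (d : ℝ) ^ E) ^ Module.finrank ℚ F| := le_abs_self _
        _ = (|B| * (d : ℝ) ^ E) ^ Module.finrank ℚ F := by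
            rw [abs_pow, abs_mul, abs_of_nonneg hdE]
        _ ≤ (max |B| 1 * (d : ℝ) ^ max E 1) ^ Module.finrank ℚ F := by
            apply pow_le_pow_left₀ (by positivity)
            exact mul_le_mul (le_max_left _ _)
              (Real.rpow_le_rpow_of_exponent_le hd1 (le_max_left _ _)) hdE
              (zero_le_one.trans hB')
    have h2' : (max |B| 1 * (d : ℝ) ^ max E 1) ^ Module.finrank ℚ F ≤
        (max |B| 1 * (d : ℝ)) ^ (max E 1 * (Module.finrank ℚ F : ℝ)) := by
      rw [Real.rpow_mul (by positivity), Real.rpow_natCast]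
      apply pow_le_pow_left₀ (by positivity)
      rw [Real.mul_rpow (by positivity) (by positivity)]
      apply mul_le_mul_of_nonneg_right _ (by positivity)
      calc max |B| 1 = (max |B| 1) ^ (1 : ℝ) := (Real.rpow_one _).symm
        _ ≤ (max |B| 1) ^ max E 1 := Real.rpow_le_rpow_of_exponent_le hB' hE'
    exact hdiscF.trans (h1.trans h2')

/-- **`OWeakUniformABCImpliesNoSiegelZeros` from the CM input of Granville–Stark's §2** — VERBATIM
the hypothesis `H` of the tree's `granville_stark_of_cmInput` (Theorem 1) and
`granville_stark_noSiegelZeros_of_cmInput` (Theorem 2): for every imaginary quadratic field `K`,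
`D = d_K`, a number field `F ∋ g₂, g₃` (algebraic integers) with an embedding `ι`,
`ι(g₂³) = j(τ_D)`, `ι(g₃²) = j(τ_D) − 1728`, `|D_F| ≤ (6√|D|)^{[F:ℚ]}` ([GranvilleStark2000, Lemma 1]:
`Δ_{k(γ₂(τ),γ₃(τ))} ≤ 6√d`; [Tafula2021, Lemma 5.4]).  Hence ONE proof of `H` discharges
`granville_stark`, `granville_stark_noSiegelZeros` (= `UniformABCImpliesNoSiegelZeros`) and
`OWeakUniformABCImpliesNoSiegelZeros`.  Proof: `of_discrBoundPoly` with `B = 6`, `E = ½`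
(`√x = x^{1/2}`), `u = g₂`, `v = g₃` (`v² = u³ − 1728` by injectivity of `ι`).
[cite: Tafula2021, Theorem 1.2 with Lemma 5.4] [cite: GranvilleStark2000, §2 Lemma 1] -/
theorem OWeakUniformABCImpliesNoSiegelZeros.of_cmInput
    (H : ∀ (K : Type) [Field K] [NumberField K], IsImaginaryQuadratic K →
      ∃ (F : Type) (_ : Field F) (_ : NumberField F) (ι : F →+* ℂ) (g₂ g₃ : 𝓞 F),
        ι ((g₂ : F) ^ 3) = formJ (principalForm (NumberField.discr K)) ∧
        ι ((g₃ : F) ^ 2) = formJ (principalForm (NumberField.discr K)) - 1728 ∧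
        |(NumberField.discr F : ℝ)| ≤ (6 * √|(NumberField.discr K : ℝ)|) ^ Module.finrank ℚ F) :
    OWeakUniformABCImpliesNoSiegelZeros := by
  refine OWeakUniformABCImpliesNoSiegelZeros.of_discrBoundPoly
    ⟨6, 1 / 2, 0, fun K _ _ h2 h0 _ ↦ ?_⟩
  have hK : IsImaginaryQuadratic K := ⟨h2, NumberField.nrRealPlaces_eq_zero_iff.mp h0⟩
  obtain ⟨F, instF, instNF, ι, g₂, g₃, hg₂, hg₃, hdiscF⟩ := H K hK
  refine ⟨F, instF, instNF, ι, g₂, g₃, hg₂, ?_, ?_⟩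
  · apply ι.injective
    rw [hg₃, map_sub, hg₂, map_ofNat]
  · rwa [Real.sqrt_eq_rpow] at hdiscF

/-- **`OWeakUniformABCImpliesNoSiegelZeros` from the Hilbert-class-field data in polynomial form**:
constants `B, E, d₁` such that every imaginary quadratic `K` with `|d_K| ≥ d₁` has a number field
`L` with a complex embedding `σ`, `j₀ ∈ 𝓞_L` with `σ(j₀) = j(τ_{d_K})`, ideals `𝔞, 𝔟` of `𝓞_L` with
`(j₀) = 𝔞³`, `(j₀ − 1728) = 𝔟²`, and `|D_L| ≤ (B|d_K|^E)^{[L:ℚ]}` — the hypothesis of the tree's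
`granville_stark_of_hilbert_cubeSquare` with `√|d_K|` relaxed to any power (for `L = K(j(τ_D))`:
`B = 1`, `E = ½`).  Proof: the Kummer tower `F = L(∛j₀, √(j₀ − 1728))` of the tree
(`exists_kummer_tower`, Bombieri–Gubler Lemma B.2.6: `|D_F| ≤ 6^{[F:ℚ]}|D_L|^{[F:L]}`) satisfies the
hypothesis of `of_discrBoundPoly` with constant `6B`.
[cite: GranvilleStark2000, §2 Lemma 1 (the factor 6)] [cite: Tafula2021, Lemma 5.4] -/
theorem OWeakUniformABCImpliesNoSiegelZeros.of_hilbert_cubeSquare_poly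
    (H : ∃ B E d₁ : ℝ, ∀ (K : Type) [Field K] [NumberField K],
      Module.finrank ℚ K = 2 → NumberField.InfinitePlace.nrRealPlaces K = 0 →
      d₁ ≤ |(NumberField.discr K : ℝ)| →
        ∃ (L : Type) (_ : Field L) (_ : NumberField L) (σ : L →+* ℂ) (j₀ : 𝓞 L)
          (𝔞 𝔟 : Ideal (𝓞 L)),
          σ j₀ = formJ (principalForm (NumberField.discr K)) ∧
          Ideal.span {j₀} = 𝔞 ^ 3 ∧ Ideal.span {j₀ - 1728} = 𝔟 ^ 2 ∧
          |(NumberField.discr L : ℝ)| ≤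
            (B * |(NumberField.discr K : ℝ)| ^ E) ^ Module.finrank ℚ L) :
    OWeakUniformABCImpliesNoSiegelZeros := by
  obtain ⟨B, E, d₁, hH⟩ := H
  refine OWeakUniformABCImpliesNoSiegelZeros.of_discrBoundPoly
    ⟨6 * B, E, d₁, fun K _ _ h2 h0 hd ↦ ?_⟩
  obtain ⟨L, _, _, σ, j₀, 𝔞, 𝔟, hσj, h𝔞, h𝔟, hDL⟩ := hH K h2 h0 hd
  obtain ⟨F, _, _, σ₀, u, v, m, hu, hv, hm, hDF⟩ := exists_kummer_tower σ j₀ 𝔞 𝔟 h𝔞 h𝔟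
  refine ⟨F, ‹_›, ‹_›, σ₀, u, v, by rw [hu, hσj], hv, ?_⟩
  have h1 : |(NumberField.discr F : ℝ)| = ((NumberField.discr F).natAbs : ℝ) := by
    rw [← Int.cast_abs, Int.abs_eq_natAbs, Int.cast_natCast]
  have h2' : |(NumberField.discr L : ℝ)| = ((NumberField.discr L).natAbs : ℝ) := by
    rw [← Int.cast_abs, Int.abs_eq_natAbs, Int.cast_natCast]
  have hDF' : ((NumberField.discr F).natAbs : ℝ) ≤
      (6 : ℝ) ^ Module.finrank ℚ F * ((NumberField.discr L).natAbs : ℝ) ^ m := by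
    exact_mod_cast hDF
  rw [h1]
  rw [h2'] at hDL
  calc ((NumberField.discr F).natAbs : ℝ)
      ≤ (6 : ℝ) ^ Module.finrank ℚ F * ((NumberField.discr L).natAbs : ℝ) ^ m := hDF'
    _ ≤ (6 : ℝ) ^ Module.finrank ℚ F *
          ((B * |(NumberField.discr K : ℝ)| ^ E) ^ Module.finrank ℚ L) ^ m := by
        gcongr
    _ = (6 * B * |(NumberField.discr K : ℝ)| ^ E) ^ Module.finrank ℚ F := by
        rw [← pow_mul, ← hm]; ring

/-- **`OWeakUniformABCImpliesNoSiegelZeros` from an unramified extension carrying the cube/square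
structure of `j(τ_D)`** — VERBATIM the hypothesis of the tree's
`granville_stark_of_unramified_cubeSquare`: for every imaginary quadratic `K` with `|d_K| ≥ d₁` a
number field `L ⊇ K`, unramified over `𝓞_K` at every maximal ideal (Mathlib's
`Algebra.IsUnramifiedAt`), with a complex embedding `σ`, `j₀ ∈ 𝓞_L` over `j(τ_{d_K})`, and ideals
`𝔞, 𝔟` with `(j₀) = 𝔞³`, `(j₀ − 1728) = 𝔟²`.  For `L = K(j(τ_D))` these are the two classical
theorems of complex multiplication still missing from Mathlib and the tree: `K(j(τ_D))/K` is
unramified ([Cox2013, Thm. 11.1]: the Hilbert class field) and the ideal-theoretic content of Weber's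
theorem on `γ₂ = ∛j`, `γ₃ = √(j − 1728)` ([Cox2013, Thm. 12.2]).  Hence ONE proof of this hypothesis
discharges `granville_stark`, `granville_stark_noSiegelZeros`, `UniformABCImpliesNoSiegelZeros` and
`OWeakUniformABCImpliesNoSiegelZeros`.  Proof: `|d_L| = |d_K|^{[L:K]} = (|d_K|^{1/2})^{[L:ℚ]}`
(`natAbs_discr_eq_pow_of_forall_isUnramifiedAt`, [NeukirchANT1999, III (2.6), (2.9), (2.10)]), so
`of_hilbert_cubeSquare_poly` applies with `B = 1`, `E = ½`.
[cite: GranvilleStark2000, §2 Lemma 1 and proof of Theorem 1] [cite: Cox2013, §11.A Thm. 11.1 and §12.A Thm. 12.2] [cite: Tafula2021, Theorem 1.2] -/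
theorem OWeakUniformABCImpliesNoSiegelZeros.of_unramified_cubeSquare
    (H : ∃ d₁ : ℝ, ∀ (K : Type) [Field K] [NumberField K],
      Module.finrank ℚ K = 2 → NumberField.InfinitePlace.nrRealPlaces K = 0 →
      d₁ ≤ |(NumberField.discr K : ℝ)| →
        ∃ (L : Type) (_ : Field L) (_ : NumberField L) (_ : Algebra K L) (σ : L →+* ℂ) (j₀ : 𝓞 L)
          (𝔞 𝔟 : Ideal (𝓞 L)),
          σ j₀ = formJ (principalForm (NumberField.discr K)) ∧
          (∀ (P : Ideal (𝓞 L)) [P.IsMaximal], Algebra.IsUnramifiedAt (𝓞 K) P) ∧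
          Ideal.span {j₀} = 𝔞 ^ 3 ∧ Ideal.span {j₀ - 1728} = 𝔟 ^ 2) :
    OWeakUniformABCImpliesNoSiegelZeros := by
  obtain ⟨d₁, hH⟩ := H
  refine OWeakUniformABCImpliesNoSiegelZeros.of_hilbert_cubeSquare_poly
    ⟨1, 1 / 2, d₁, fun K _ _ h2 h0 hd ↦ ?_⟩
  obtain ⟨L, instF, instNF, instA, σ, j₀, 𝔞, 𝔟, hσ, hunr, h𝔞, h𝔟⟩ := hH K h2 h0 hd
  refine ⟨L, instF, instNF, σ, j₀, 𝔞, 𝔟, hσ, h𝔞, h𝔟, le_of_eq ?_⟩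
  have hdisc := natAbs_discr_eq_pow_of_forall_isUnramifiedAt (K := K) (L := L) hunr
  haveI : Module.Free ℚ K := Module.Free.of_divisionRing ℚ K
  haveI : Module.Free K L := Module.Free.of_divisionRing K L
  have hdeg : Module.finrank ℚ L = 2 * Module.finrank K L := by
    rw [← h2, Module.finrank_mul_finrank]
  have h1 : |(NumberField.discr L : ℝ)| = ((NumberField.discr L).natAbs : ℝ) := by
    rw [← Int.cast_abs, Int.abs_eq_natAbs, Int.cast_natCast]
  have h2' : |(NumberField.discr K : ℝ)| = ((NumberField.discr K).natAbs : ℝ) := by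
    rw [← Int.cast_abs, Int.abs_eq_natAbs, Int.cast_natCast]
  rw [one_mul, ← Real.sqrt_eq_rpow, hdeg, pow_mul, Real.sq_sqrt (abs_nonneg _), h1, hdisc, h2']
  push_cast
  ring

/-- The same unramified cube/square data therefore also settle the catalogued entry
`UniformABCImpliesNoSiegelZeros` (`= granville_stark_noSiegelZeros`, [GranvilleStark2000, Theorem 2]),
through the `O`-weak one (`UniformABCImpliesNoSiegelZeros.of_oWeak`). [cite: GranvilleStark2000, Theorem 2 with Lemma 1] -/
theorem UniformABCImpliesNoSiegelZeros.of_unramified_cubeSquare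
    (H : ∃ d₁ : ℝ, ∀ (K : Type) [Field K] [NumberField K],
      Module.finrank ℚ K = 2 → NumberField.InfinitePlace.nrRealPlaces K = 0 →
      d₁ ≤ |(NumberField.discr K : ℝ)| →
        ∃ (L : Type) (_ : Field L) (_ : NumberField L) (_ : Algebra K L) (σ : L →+* ℂ) (j₀ : 𝓞 L)
          (𝔞 𝔟 : Ideal (𝓞 L)),
          σ j₀ = formJ (principalForm (NumberField.discr K)) ∧
          (∀ (P : Ideal (𝓞 L)) [P.IsMaximal], Algebra.IsUnramifiedAt (𝓞 K) P) ∧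
          Ideal.span {j₀} = 𝔞 ^ 3 ∧ Ideal.span {j₀ - 1728} = 𝔟 ^ 2) :
    UniformABCImpliesNoSiegelZeros :=
  UniformABCImpliesNoSiegelZeros.of_oWeak (OWeakUniformABCImpliesNoSiegelZeros.of_unramified_cubeSquare H)

end CMDatumAlone

/-! ### Session 2 (cont.): the unramifiedness input (U) from class field theory — the entry from the
Hilbert class field and the cube/square structure of `(j)`, `(j − 1728)`

With `Literature.NumberTheory.EllipticCurves.exists_unramified_formJ_of_hilbertClassField`
(`SingularModuliHilbertClassField.lean`: Deuring's congruence argument for the splitting of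
principal-form primes in the field of singular moduli, Bauer's theorem, and the norm form of `𝓞_K`)
the hypothesis of `.of_unramified_cubeSquare` splits into two INDEPENDENT classical statements, one of
pure class field theory and one of pure complex multiplication:

* (HCF) for every imaginary quadratic `K`, a finite Galois `H ⊂ K̄` over `K`, unramified over `𝓞_K` at
  every maximal ideal, in which all but finitely many degree-one primes of `K` that split completely
  are principal — the Hilbert class field [Cox2013, Thm. 8.10 with Cor. 5.21; Thm. 8.19];
* (C) in every number field `L ⊇ K` with an embedding `σ : L → ℂ` and `j₀ ∈ 𝓞_L` over `j(τ_{d_K})`,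
  `(j₀) = 𝔞³` and `(j₀ − 1728) = 𝔟²` as ideals (equivalently in `K(j(τ_{d_K}))`: the ideal-theoretic
  content of Weber's `γ₂(τ), γ₃(τ)` [Cox2013, Thm. 12.2], for `|d_K|` large).

Neither is restated as a named fact (D-0026). -/

section HilbertClassField

open NumberField
open _root_.Literature.NumberTheory.NumberFields
open _root_.Literature.NumberTheory.GaloisRepresentations (splitPrimes)
open _root_.IsDedekindDomain (HeightOneSpectrum)

/-- **`OWeakUniformABCImpliesNoSiegelZeros` from the Hilbert class field (HCF) and the cube/square
datum (C)** — see the section docstring for the two hypotheses; the unramified extension `L ⊇ K`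
carrying `j₀` over `j(τ_{d_K})` is produced by
`Literature.NumberTheory.EllipticCurves.exists_unramified_formJ_of_hilbertClassField`, and (C) supplies
the ideals `𝔞, 𝔟` in that `L`, so that `.of_unramified_cubeSquare` applies.
[cite: Tafula2021, Theorem 1.2 with Lemma 5.4] [cite: Cox2013, §8.A Thm. 8.10, §11.A Thm. 11.1, §12.A Thm. 12.2]
[cite: GranvilleStark2000, §2 Lemma 1] -/
theorem OWeakUniformABCImpliesNoSiegelZeros.of_hilbertClassField_of_cubeSquare
    (hHCF : ∀ (K : Type) [Field K] [NumberField K], IsImaginaryQuadratic K →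
      ∃ H : IntermediateField K (AlgebraicClosure K), FiniteDimensional K H ∧ IsGalois K H ∧
        (∀ (P : Ideal (𝓞 H)) [P.IsMaximal], Algebra.IsUnramifiedAt (𝓞 K) P) ∧
        ∀ᶠ v : HeightOneSpectrum (𝓞 K) in Filter.cofinite, (Ideal.absNorm v.asIdeal).Prime →
          v ∈ splitPrimes K H → v.asIdeal.IsPrincipal)
    (hC : ∃ d₁ : ℝ, ∀ (K : Type) [Field K] [NumberField K], IsImaginaryQuadratic K →
      d₁ ≤ |(NumberField.discr K : ℝ)| →
      ∀ (L : Type) [Field L] [NumberField L] [Algebra K L] (σ : L →+* ℂ) (j₀ : 𝓞 L),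
        σ j₀ = formJ (principalForm (NumberField.discr K)) →
        ∃ 𝔞 𝔟 : Ideal (𝓞 L), Ideal.span {j₀} = 𝔞 ^ 3 ∧ Ideal.span {j₀ - 1728} = 𝔟 ^ 2) :
    OWeakUniformABCImpliesNoSiegelZeros := by
  obtain ⟨d₁, hC⟩ := hC
  refine OWeakUniformABCImpliesNoSiegelZeros.of_unramified_cubeSquare ⟨d₁, fun K _ _ h2 h0 hd ↦ ?_⟩
  have hK : IsImaginaryQuadratic K := ⟨h2, NumberField.nrRealPlaces_eq_zero_iff.mp h0⟩
  obtain ⟨L, instF, instNF, instA, σ, j₀, hσ, hunr⟩ :=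
    exists_unramified_formJ_of_hilbertClassField K hK (hHCF K hK)
  obtain ⟨𝔞, 𝔟, h𝔞, h𝔟⟩ := hC K hK hd L σ j₀ hσ
  exact ⟨L, instF, instNF, instA, σ, j₀, 𝔞, 𝔟, hσ, hunr, h𝔞, h𝔟⟩

/-- The same two inputs give the catalogued entry `UniformABCImpliesNoSiegelZeros`
(`= granville_stark_noSiegelZeros`, [GranvilleStark2000, Theorem 2]). [cite: GranvilleStark2000, Theorem 2 with Lemma 1] -/
theorem UniformABCImpliesNoSiegelZeros.of_hilbertClassField_of_cubeSquare
    (hHCF : ∀ (K : Type) [Field K] [NumberField K], IsImaginaryQuadratic K →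
      ∃ H : IntermediateField K (AlgebraicClosure K), FiniteDimensional K H ∧ IsGalois K H ∧
        (∀ (P : Ideal (𝓞 H)) [P.IsMaximal], Algebra.IsUnramifiedAt (𝓞 K) P) ∧
        ∀ᶠ v : HeightOneSpectrum (𝓞 K) in Filter.cofinite, (Ideal.absNorm v.asIdeal).Prime →
          v ∈ splitPrimes K H → v.asIdeal.IsPrincipal)
    (hC : ∃ d₁ : ℝ, ∀ (K : Type) [Field K] [NumberField K], IsImaginaryQuadratic K →
      d₁ ≤ |(NumberField.discr K : ℝ)| →
      ∀ (L : Type) [Field L] [NumberField L] [Algebra K L] (σ : L →+* ℂ) (j₀ : 𝓞 L),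
        σ j₀ = formJ (principalForm (NumberField.discr K)) →
        ∃ 𝔞 𝔟 : Ideal (𝓞 L), Ideal.span {j₀} = 𝔞 ^ 3 ∧ Ideal.span {j₀ - 1728} = 𝔟 ^ 2) :
    UniformABCImpliesNoSiegelZeros :=
  UniformABCImpliesNoSiegelZeros.of_oWeak
    (OWeakUniformABCImpliesNoSiegelZeros.of_hilbertClassField_of_cubeSquare hHCF hC)

/-- And Granville–Stark's Theorem 1 itself (abc.S22, `granville_stark`:
`UniformABCConjecture → ImaginaryQuadraticClassNumberBound`) from the same two inputs, through the
tree's `granville_stark_of_unramified_cubeSquare`. [cite: GranvilleStark2000, Theorem 1 with Lemma 1] -/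
theorem granville_stark_of_hilbertClassField_of_cubeSquare
    (hHCF : ∀ (K : Type) [Field K] [NumberField K], IsImaginaryQuadratic K →
      ∃ H : IntermediateField K (AlgebraicClosure K), FiniteDimensional K H ∧ IsGalois K H ∧
        (∀ (P : Ideal (𝓞 H)) [P.IsMaximal], Algebra.IsUnramifiedAt (𝓞 K) P) ∧
        ∀ᶠ v : HeightOneSpectrum (𝓞 K) in Filter.cofinite, (Ideal.absNorm v.asIdeal).Prime →
          v ∈ splitPrimes K H → v.asIdeal.IsPrincipal)
    (hC : ∃ d₁ : ℝ, ∀ (K : Type) [Field K] [NumberField K], IsImaginaryQuadratic K →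
      d₁ ≤ |(NumberField.discr K : ℝ)| →
      ∀ (L : Type) [Field L] [NumberField L] [Algebra K L] (σ : L →+* ℂ) (j₀ : 𝓞 L),
        σ j₀ = formJ (principalForm (NumberField.discr K)) →
        ∃ 𝔞 𝔟 : Ideal (𝓞 L), Ideal.span {j₀} = 𝔞 ^ 3 ∧ Ideal.span {j₀ - 1728} = 𝔟 ^ 2) :
    granville_stark := by
  obtain ⟨d₁, hC⟩ := hC
  refine granville_stark_of_unramified_cubeSquare ⟨d₁, fun K _ _ h2 h0 hd ↦ ?_⟩
  have hK : IsImaginaryQuadratic K := ⟨h2, NumberField.nrRealPlaces_eq_zero_iff.mp h0⟩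
  obtain ⟨L, instF, instNF, instA, σ, j₀, hσ, hunr⟩ :=
    exists_unramified_formJ_of_hilbertClassField K hK (hHCF K hK)
  obtain ⟨𝔞, 𝔟, h𝔞, h𝔟⟩ := hC K hK hd L σ j₀ hσ
  exact ⟨L, instF, instNF, instA, σ, j₀, 𝔞, 𝔟, hσ, hunr, h𝔞, h𝔟⟩

end HilbertClassField

/-! ### (HCF) from the Artin reciprocity description of a class field: the entry from the EXISTENCE of
the Hilbert class field (abstract class field `E/K` with injective `Φ : Cl(𝓞_K) → Gal(E/K)`,
`Frob_v = Φ([v])`) and the cube/square datum -/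

section ClassField

open NumberField
open _root_.Literature.NumberTheory.NumberFields
open _root_.Literature.NumberTheory.GaloisRepresentations (splitPrimes galFrob)
open _root_.IsDedekindDomain (HeightOneSpectrum)
open scoped nonZeroDivisors

/-- **`OWeakUniformABCImpliesNoSiegelZeros` from the existence of the Hilbert class field in its
Artin-reciprocity form (HCF′) and the cube/square datum (C).**  (HCF′): for every imaginary quadratic
`K` a finite abelian extension `E/K` with an injective homomorphism `Φ : Cl(𝓞_K) → Gal(E/K)` such that
`Frob_v = Φ([v])` for almost all primes `v` unramified in `E` — the class field of `Kˣ·U_K` with its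
Artin symbol [Cox2013, Thm. 8.10], i.e. the output of the existence theorem of global class field
theory; by `Literature.NumberTheory.NumberFields.exists_hilbertClassField_data_of_classField`
(ramification and splitting through the tree's PROVED Artin reciprocity) it yields (HCF), and
`.of_hilbertClassField_of_cubeSquare` applies. [cite: Tafula2021, Theorem 1.2 with Lemma 5.4]
[cite: Cox2013, §8.A Thm. 8.10, §11.A Thm. 11.1, §12.A Thm. 12.2] [cite: GranvilleStark2000, §2 Lemma 1] -/
theorem OWeakUniformABCImpliesNoSiegelZeros.of_classField_of_cubeSquare
    (hCF : ∀ (K : Type) [Field K] [NumberField K], IsImaginaryQuadratic K →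
      ∃ (E : Type) (_ : Field E) (_ : NumberField E) (_ : Algebra K E) (_ : IsAbelianGalois K E)
        (Φ : ClassGroup (𝓞 K) →* (E ≃ₐ[K] E)), Function.Injective Φ ∧
        ∀ᶠ v : HeightOneSpectrum (𝓞 K) in Filter.cofinite, Algebra.IsUnramifiedIn (𝓞 E) v.asIdeal →
          galFrob K E v = Φ (ClassGroup.mk0 ⟨v.asIdeal, asIdeal_mem_nonZeroDivisors v⟩))
    (hC : ∃ d₁ : ℝ, ∀ (K : Type) [Field K] [NumberField K], IsImaginaryQuadratic K →
      d₁ ≤ |(NumberField.discr K : ℝ)| →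
      ∀ (L : Type) [Field L] [NumberField L] [Algebra K L] (σ : L →+* ℂ) (j₀ : 𝓞 L),
        σ j₀ = formJ (principalForm (NumberField.discr K)) →
        ∃ 𝔞 𝔟 : Ideal (𝓞 L), Ideal.span {j₀} = 𝔞 ^ 3 ∧ Ideal.span {j₀ - 1728} = 𝔟 ^ 2) :
    OWeakUniformABCImpliesNoSiegelZeros := by
  refine OWeakUniformABCImpliesNoSiegelZeros.of_hilbertClassField_of_cubeSquare (fun K _ _ hK ↦ ?_) hC
  obtain ⟨E, _, _, _, _, Φ, hinj, hΦ⟩ := hCF K hK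
  exact exists_hilbertClassField_data_of_classField E Φ hinj hΦ

/-- The same for the catalogued entry `UniformABCImpliesNoSiegelZeros`. [cite: GranvilleStark2000, Theorem 2 with Lemma 1] -/
theorem UniformABCImpliesNoSiegelZeros.of_classField_of_cubeSquare
    (hCF : ∀ (K : Type) [Field K] [NumberField K], IsImaginaryQuadratic K →
      ∃ (E : Type) (_ : Field E) (_ : NumberField E) (_ : Algebra K E) (_ : IsAbelianGalois K E)
        (Φ : ClassGroup (𝓞 K) →* (E ≃ₐ[K] E)), Function.Injective Φ ∧
        ∀ᶠ v : HeightOneSpectrum (𝓞 K) in Filter.cofinite, Algebra.IsUnramifiedIn (𝓞 E) v.asIdeal →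
          galFrob K E v = Φ (ClassGroup.mk0 ⟨v.asIdeal, asIdeal_mem_nonZeroDivisors v⟩))
    (hC : ∃ d₁ : ℝ, ∀ (K : Type) [Field K] [NumberField K], IsImaginaryQuadratic K →
      d₁ ≤ |(NumberField.discr K : ℝ)| →
      ∀ (L : Type) [Field L] [NumberField L] [Algebra K L] (σ : L →+* ℂ) (j₀ : 𝓞 L),
        σ j₀ = formJ (principalForm (NumberField.discr K)) →
        ∃ 𝔞 𝔟 : Ideal (𝓞 L), Ideal.span {j₀} = 𝔞 ^ 3 ∧ Ideal.span {j₀ - 1728} = 𝔟 ^ 2) :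
    UniformABCImpliesNoSiegelZeros :=
  UniformABCImpliesNoSiegelZeros.of_oWeak
    (OWeakUniformABCImpliesNoSiegelZeros.of_classField_of_cubeSquare hCF hC)

/-- And Granville–Stark's Theorem 1 (`granville_stark`). [cite: GranvilleStark2000, Theorem 1 with Lemma 1] -/
theorem granville_stark_of_classField_of_cubeSquare
    (hCF : ∀ (K : Type) [Field K] [NumberField K], IsImaginaryQuadratic K →
      ∃ (E : Type) (_ : Field E) (_ : NumberField E) (_ : Algebra K E) (_ : IsAbelianGalois K E)
        (Φ : ClassGroup (𝓞 K) →* (E ≃ₐ[K] E)), Function.Injective Φ ∧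
        ∀ᶠ v : HeightOneSpectrum (𝓞 K) in Filter.cofinite, Algebra.IsUnramifiedIn (𝓞 E) v.asIdeal →
          galFrob K E v = Φ (ClassGroup.mk0 ⟨v.asIdeal, asIdeal_mem_nonZeroDivisors v⟩))
    (hC : ∃ d₁ : ℝ, ∀ (K : Type) [Field K] [NumberField K], IsImaginaryQuadratic K →
      d₁ ≤ |(NumberField.discr K : ℝ)| →
      ∀ (L : Type) [Field L] [NumberField L] [Algebra K L] (σ : L →+* ℂ) (j₀ : 𝓞 L),
        σ j₀ = formJ (principalForm (NumberField.discr K)) →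
        ∃ 𝔞 𝔟 : Ideal (𝓞 L), Ideal.span {j₀} = 𝔞 ^ 3 ∧ Ideal.span {j₀ - 1728} = 𝔟 ^ 2) :
    granville_stark := by
  refine granville_stark_of_hilbertClassField_of_cubeSquare (fun K _ _ hK ↦ ?_) hC
  obtain ⟨E, _, _, _, _, Φ, hinj, hΦ⟩ := hCF K hK
  exact exists_hilbertClassField_data_of_classField E Φ hinj hΦ

end ClassField

/-! ### (HCF) discharged: the entry from the cube/square datum (C) alone

`Literature.NumberTheory.NumberFields.exists_hilbertClassField_data` (the Hilbert class field of every
number field, unramified with only principal primes splitting completely — from the tree's proved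
global class field theory) discharges the hypothesis (HCF) of `.of_hilbertClassField_of_cubeSquare`.
What remains between the tree and `OWeakUniformABCImpliesNoSiegelZeros_holds` (and
`granville_stark_holds`, `granville_stark_noSiegelZeros_holds`) is the single complex-multiplication
statement (C): in every number field `L ⊇ K` with `j₀ ∈ 𝓞_L` over `j(τ_{d_K})`, `(j₀) = 𝔞³` and
`(j₀ − 1728) = 𝔟²` as ideals (the ideal-theoretic content of Weber's `γ₂, γ₃`, [Cox2013, Thm. 12.2];
equivalently inertia acts on CM curves through `μ(𝒪_K) = {±1}`). -/

section CubeSquare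

open NumberField
open _root_.Literature.NumberTheory.NumberFields (exists_hilbertClassField_data)

/-- **`OWeakUniformABCImpliesNoSiegelZeros` from the cube/square datum (C) alone** — class field
theory (the Hilbert class field, `exists_hilbertClassField_data`), Deuring's congruence argument,
Bauer's theorem, eq. (11) and the height argument being all proved in the tree.
[cite: Tafula2021, Theorem 1.2 with Lemma 5.4] [cite: Cox2013, §12.A Thm. 12.2] [cite: GranvilleStark2000, §2 Lemma 1] -/
theorem OWeakUniformABCImpliesNoSiegelZeros.of_cubeSquare
    (hC : ∃ d₁ : ℝ, ∀ (K : Type) [Field K] [NumberField K], IsImaginaryQuadratic K →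
      d₁ ≤ |(NumberField.discr K : ℝ)| →
      ∀ (L : Type) [Field L] [NumberField L] [Algebra K L] (σ : L →+* ℂ) (j₀ : 𝓞 L),
        σ j₀ = formJ (principalForm (NumberField.discr K)) →
        ∃ 𝔞 𝔟 : Ideal (𝓞 L), Ideal.span {j₀} = 𝔞 ^ 3 ∧ Ideal.span {j₀ - 1728} = 𝔟 ^ 2) :
    OWeakUniformABCImpliesNoSiegelZeros :=
  OWeakUniformABCImpliesNoSiegelZeros.of_hilbertClassField_of_cubeSquare
    (fun K _ _ _ ↦ exists_hilbertClassField_data K) hC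

/-- The same for the catalogued entry `UniformABCImpliesNoSiegelZeros` (`= granville_stark_noSiegelZeros`).
[cite: GranvilleStark2000, Theorem 2 with Lemma 1] -/
theorem UniformABCImpliesNoSiegelZeros.of_cubeSquare
    (hC : ∃ d₁ : ℝ, ∀ (K : Type) [Field K] [NumberField K], IsImaginaryQuadratic K →
      d₁ ≤ |(NumberField.discr K : ℝ)| →
      ∀ (L : Type) [Field L] [NumberField L] [Algebra K L] (σ : L →+* ℂ) (j₀ : 𝓞 L),
        σ j₀ = formJ (principalForm (NumberField.discr K)) →
        ∃ 𝔞 𝔟 : Ideal (𝓞 L), Ideal.span {j₀} = 𝔞 ^ 3 ∧ Ideal.span {j₀ - 1728} = 𝔟 ^ 2) :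
    UniformABCImpliesNoSiegelZeros :=
  UniformABCImpliesNoSiegelZeros.of_oWeak (OWeakUniformABCImpliesNoSiegelZeros.of_cubeSquare hC)

/-- And Granville–Stark's Theorem 1 (`granville_stark`, abc.S22) from (C) alone. [cite: GranvilleStark2000, Theorem 1 with Lemma 1] -/
theorem granville_stark_of_cubeSquare
    (hC : ∃ d₁ : ℝ, ∀ (K : Type) [Field K] [NumberField K], IsImaginaryQuadratic K →
      d₁ ≤ |(NumberField.discr K : ℝ)| →
      ∀ (L : Type) [Field L] [NumberField L] [Algebra K L] (σ : L →+* ℂ) (j₀ : 𝓞 L),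
        σ j₀ = formJ (principalForm (NumberField.discr K)) →
        ∃ 𝔞 𝔟 : Ideal (𝓞 L), Ideal.span {j₀} = 𝔞 ^ 3 ∧ Ideal.span {j₀ - 1728} = 𝔟 ^ 2) :
    granville_stark :=
  granville_stark_of_hilbertClassField_of_cubeSquare (fun K _ _ _ ↦ exists_hilbertClassField_data K) hC

end CubeSquare

/-! ### The canonical form of the remaining hypothesis (C): one subfield of `ℂ` per discriminant -/

section Canonical

open NumberField
open _root_.Literature.NumberTheory.QuadraticFields.Quadratic (exists_sq_eq_discr discr_emod_four)

/-- The square roots of a negative integer `D` in `ℂ` are `± i√|D|`. [folklore] -/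
theorem eq_or_eq_neg_of_sq_eq_intCast {D : ℤ} (hD : D < 0) {z : ℂ}
    (hz : z ^ 2 = (D : ℂ)) :
    z = Complex.I * (Real.sqrt (-(D : ℝ)) : ℂ) ∨ z = -(Complex.I * (Real.sqrt (-(D : ℝ)) : ℂ)) := by
  have hs : (Complex.I * (Real.sqrt (-(D : ℝ)) : ℂ)) ^ 2 = (D : ℂ) := by
    have h0 : (0 : ℝ) ≤ -(D : ℝ) := by
      have : (D : ℝ) < 0 := by exact_mod_cast hD
      linarith
    rw [mul_pow, Complex.I_sq, ← Complex.ofReal_pow, Real.sq_sqrt h0]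
    push_cast
    ring
  have h : (z - Complex.I * (Real.sqrt (-(D : ℝ)) : ℂ)) *
      (z + Complex.I * (Real.sqrt (-(D : ℝ)) : ℂ)) = 0 := by
    linear_combination hz - hs
  rcases mul_eq_zero.mp h with h1 | h1
  · exact Or.inl (sub_eq_zero.mp h1)
  · exact Or.inr (eq_neg_of_add_eq_zero_left h1)

/-- **(C) from its canonical instance.**  The cube/square hypothesis (C) of `.of_cubeSquare` — for
all `(L ⊇ K, σ : L → ℂ, j₀)` with `σ(j₀) = j(τ_{d_K})` — follows from the single instance in the
subfield `F = ℚ(j(τ_{d_K}), i√|d_K|) = K(j(τ_{d_K})) ⊂ ℂ` (the Hilbert class field of `K`, embedded):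
`σ(L) ⊇ F` (it contains `σ(√d_K) = ± i√|d_K|`, `exists_sq_eq_discr`), so there is a ring homomorphism
`f : F → L` with `σ ∘ f = id`, `f(j(τ_{d_K})) = j₀`, and cubes/squares of ideals extend along
`𝓞_F → 𝓞_L` (`RingOfIntegers.mapRingHom`, `Ideal.map_pow`). [folklore] -/
theorem cubeSquare_of_canonical
    (hC : ∃ d₁ : ℝ, ∀ (K : Type) [Field K] [NumberField K], IsImaginaryQuadratic K →
      d₁ ≤ |(NumberField.discr K : ℝ)| →
      ∀ j₁ : 𝓞 (IntermediateField.adjoin ℚ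
          ({formJ (principalForm (NumberField.discr K)),
            Complex.I * (Real.sqrt (-(NumberField.discr K : ℝ)) : ℂ)} : Set ℂ)),
        ((j₁ : IntermediateField.adjoin ℚ
          ({formJ (principalForm (NumberField.discr K)),
            Complex.I * (Real.sqrt (-(NumberField.discr K : ℝ)) : ℂ)} : Set ℂ)) : ℂ) =
          formJ (principalForm (NumberField.discr K)) →
        ∃ 𝔞 𝔟 : Ideal (𝓞 (IntermediateField.adjoin ℚ
          ({formJ (principalForm (NumberField.discr K)),
            Complex.I * (Real.sqrt (-(NumberField.discr K : ℝ)) : ℂ)} : Set ℂ))),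
          Ideal.span {j₁} = 𝔞 ^ 3 ∧ Ideal.span {j₁ - 1728} = 𝔟 ^ 2) :
    ∃ d₁ : ℝ, ∀ (K : Type) [Field K] [NumberField K], IsImaginaryQuadratic K →
      d₁ ≤ |(NumberField.discr K : ℝ)| →
      ∀ (L : Type) [Field L] [NumberField L] [Algebra K L] (σ : L →+* ℂ) (j₀ : 𝓞 L),
        σ j₀ = formJ (principalForm (NumberField.discr K)) →
        ∃ 𝔞 𝔟 : Ideal (𝓞 L), Ideal.span {j₀} = 𝔞 ^ 3 ∧ Ideal.span {j₀ - 1728} = 𝔟 ^ 2 := by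
  classical
  obtain ⟨d₁, hC⟩ := hC
  refine ⟨d₁, fun K _ _ hK hd L _ _ _ σ j₀ hσ ↦ ?_⟩
  have h2 : Module.finrank ℚ K = 2 := hK.1
  have hD : NumberField.discr K < 0 := hK.discr_neg
  have h4 : NumberField.discr K % 4 = 0 ∨ NumberField.discr K % 4 = 1 := discr_emod_four h2
  set D := NumberField.discr K with hDdef
  set jD : ℂ := formJ (principalForm D) with hjD
  set δ : ℂ := Complex.I * (Real.sqrt (-(D : ℝ)) : ℂ) with hδ
  set F : IntermediateField ℚ ℂ := IntermediateField.adjoin ℚ ({jD, δ} : Set ℂ) with hFdef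
  -- `F ⊆ σ(L)`
  have hjmem : jD ∈ σ.fieldRange := RingHom.mem_fieldRange.mpr ⟨(j₀ : L), hσ⟩
  have hδmem : δ ∈ σ.fieldRange := by
    obtain ⟨-, -, δK, -, hδK⟩ := exists_sq_eq_discr (K := K) h2
    have hK2 : ((δK : K)) ^ 2 = (D : K) := by
      have := congrArg (fun x : 𝓞 K => (x : K)) hδK
      push_cast at this
      exact this
    set z : ℂ := σ (algebraMap K L (δK : K)) with hz
    have hz2 : z ^ 2 = (D : ℂ) := by
      rw [hz, ← map_pow, ← map_pow, hK2, map_intCast, map_intCast]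
    have hzmem : z ∈ σ.fieldRange := RingHom.mem_fieldRange.mpr ⟨_, rfl⟩
    rcases eq_or_eq_neg_of_sq_eq_intCast hD hz2 with h | h
    · rw [hδ, ← h]; exact hzmem
    · have : δ = -z := by rw [h, neg_neg]
      rw [this]; exact neg_mem hzmem
  set E' : IntermediateField ℚ ℂ := σ.fieldRange.toIntermediateField
    (fun q => RingHom.mem_fieldRange.mpr ⟨(q : L), by simp⟩) with hE'
  have hle : F ≤ E' := by
    rw [hFdef, IntermediateField.adjoin_le_iff]
    intro x hx
    rcases hx with rfl | rfl
    · exact hjmem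
    · exact hδmem
  have hle' : F.toSubfield ≤ σ.fieldRange := fun x hx => hle hx
  -- the ring homomorphism `f : F → L` with `σ ∘ f = incl`
  set f : F →+* L := (σ.rangeRestrictFieldEquiv.symm.toRingHom).comp (Subfield.inclusion hle')
    with hfdef
  have hσf : ∀ x : F, σ (f x) = (x : ℂ) := fun x =>
    RingHom.rangeRestrictFieldEquiv_apply_symm_apply σ ⟨x, hle' x.2⟩
  -- `j(τ_D)` as an algebraic integer of `F`
  have hjF : jD ∈ F := IntermediateField.subset_adjoin ℚ _ (Set.mem_insert _ _)
  have hintC : IsIntegral ℤ jD :=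
    isIntegral_int_formJ (by rw [principalForm_fst]; exact one_pos) (isPrimitive_principalForm _)
      (by rw [discr_principalForm h4]; exact hD)
  have hintF : IsIntegral ℤ (⟨jD, hjF⟩ : F) :=
    (isIntegral_algHom_iff (IntermediateField.val F).toRingHom.toIntAlgHom Subtype.val_injective).mp
      hintC
  set j₁ : 𝓞 F := ⟨⟨jD, hjF⟩, hintF⟩ with hj₁
  have hj₁C : ((j₁ : F) : ℂ) = jD := rfl
  obtain ⟨𝔞, 𝔟, h𝔞, h𝔟⟩ := hC K hK hd j₁ hj₁C
  -- transport along `g : 𝓞 F → 𝓞 L`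
  set g : 𝓞 F →+* 𝓞 L := RingOfIntegers.mapRingHom f with hg
  have hgj : g j₁ = j₀ := by
    have h1 : ((g j₁ : 𝓞 L) : L) = (j₀ : L) := by
      apply σ.injective
      rw [hg, RingOfIntegers.mapRingHom_apply, hσf, hj₁C, hσ]
    exact RingOfIntegers.ext h1
  refine ⟨𝔞.map g, 𝔟.map g, ?_, ?_⟩
  · have := congrArg (Ideal.map g) h𝔞
    rwa [Ideal.map_span, Set.image_singleton, Ideal.map_pow, hgj] at this
  · have := congrArg (Ideal.map g) h𝔟
    rwa [Ideal.map_span, Set.image_singleton, Ideal.map_pow, map_sub, hgj, map_ofNat] at this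


/-- **`OWeakUniformABCImpliesNoSiegelZeros` from the canonical cube/square statement (C_can):** for
imaginary quadratic `K` with `|d_K|` large, in the ring of integers of
`F = ℚ(j(τ_{d_K}), i√|d_K|) ⊂ ℂ`, the ideal `(j(τ_{d_K}))` is a cube and `(j(τ_{d_K}) − 1728)` is a
square ([Cox2013, Thm. 12.2]: Weber's `γ₂(τ₀)³ = j(τ₀)`, `γ₃(τ₀)² = j(τ₀) − 1728` with
`γ₂(τ₀), √d_K·γ₃(τ₀) ∈ K(j(τ₀))` for `6 ∤ d_K`, and the ring class fields of conductor `2, 3` in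
general).  This is everything that stands between the tree and `OWeakUniformABCImpliesNoSiegelZeros_holds`.
[cite: Tafula2021, Theorem 1.2 with Lemma 5.4] [cite: Cox2013, §12.A Thm. 12.2] [cite: GranvilleStark2000, §2 Lemma 1] -/
theorem OWeakUniformABCImpliesNoSiegelZeros.of_cubeSquare_canonical
    (hC : ∃ d₁ : ℝ, ∀ (K : Type) [Field K] [NumberField K], IsImaginaryQuadratic K →
      d₁ ≤ |(NumberField.discr K : ℝ)| →
      ∀ j₁ : 𝓞 (IntermediateField.adjoin ℚ
          ({formJ (principalForm (NumberField.discr K)),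
            Complex.I * (Real.sqrt (-(NumberField.discr K : ℝ)) : ℂ)} : Set ℂ)),
        ((j₁ : IntermediateField.adjoin ℚ
          ({formJ (principalForm (NumberField.discr K)),
            Complex.I * (Real.sqrt (-(NumberField.discr K : ℝ)) : ℂ)} : Set ℂ)) : ℂ) =
          formJ (principalForm (NumberField.discr K)) →
        ∃ 𝔞 𝔟 : Ideal (𝓞 (IntermediateField.adjoin ℚ
          ({formJ (principalForm (NumberField.discr K)),
            Complex.I * (Real.sqrt (-(NumberField.discr K : ℝ)) : ℂ)} : Set ℂ))),
          Ideal.span {j₁} = 𝔞 ^ 3 ∧ Ideal.span {j₁ - 1728} = 𝔟 ^ 2) :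
    OWeakUniformABCImpliesNoSiegelZeros :=
  OWeakUniformABCImpliesNoSiegelZeros.of_cubeSquare (cubeSquare_of_canonical hC)

/-- The same for `UniformABCImpliesNoSiegelZeros`. [cite: GranvilleStark2000, Theorem 2 with Lemma 1] -/
theorem UniformABCImpliesNoSiegelZeros.of_cubeSquare_canonical
    (hC : ∃ d₁ : ℝ, ∀ (K : Type) [Field K] [NumberField K], IsImaginaryQuadratic K →
      d₁ ≤ |(NumberField.discr K : ℝ)| →
      ∀ j₁ : 𝓞 (IntermediateField.adjoin ℚ
          ({formJ (principalForm (NumberField.discr K)),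
            Complex.I * (Real.sqrt (-(NumberField.discr K : ℝ)) : ℂ)} : Set ℂ)),
        ((j₁ : IntermediateField.adjoin ℚ
          ({formJ (principalForm (NumberField.discr K)),
            Complex.I * (Real.sqrt (-(NumberField.discr K : ℝ)) : ℂ)} : Set ℂ)) : ℂ) =
          formJ (principalForm (NumberField.discr K)) →
        ∃ 𝔞 𝔟 : Ideal (𝓞 (IntermediateField.adjoin ℚ
          ({formJ (principalForm (NumberField.discr K)),
            Complex.I * (Real.sqrt (-(NumberField.discr K : ℝ)) : ℂ)} : Set ℂ))),
          Ideal.span {j₁} = 𝔞 ^ 3 ∧ Ideal.span {j₁ - 1728} = 𝔟 ^ 2) :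
    UniformABCImpliesNoSiegelZeros :=
  UniformABCImpliesNoSiegelZeros.of_cubeSquare (cubeSquare_of_canonical hC)

/-- And `granville_stark` (abc.S22 Theorem 1). [cite: GranvilleStark2000, Theorem 1 with Lemma 1] -/
theorem granville_stark_of_cubeSquare_canonical
    (hC : ∃ d₁ : ℝ, ∀ (K : Type) [Field K] [NumberField K], IsImaginaryQuadratic K →
      d₁ ≤ |(NumberField.discr K : ℝ)| →
      ∀ j₁ : 𝓞 (IntermediateField.adjoin ℚ
          ({formJ (principalForm (NumberField.discr K)),
            Complex.I * (Real.sqrt (-(NumberField.discr K : ℝ)) : ℂ)} : Set ℂ)),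
        ((j₁ : IntermediateField.adjoin ℚ
          ({formJ (principalForm (NumberField.discr K)),
            Complex.I * (Real.sqrt (-(NumberField.discr K : ℝ)) : ℂ)} : Set ℂ)) : ℂ) =
          formJ (principalForm (NumberField.discr K)) →
        ∃ 𝔞 𝔟 : Ideal (𝓞 (IntermediateField.adjoin ℚ
          ({formJ (principalForm (NumberField.discr K)),
            Complex.I * (Real.sqrt (-(NumberField.discr K : ℝ)) : ℂ)} : Set ℂ))),
          Ideal.span {j₁} = 𝔞 ^ 3 ∧ Ideal.span {j₁ - 1728} = 𝔟 ^ 2) :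
    granville_stark :=
  granville_stark_of_cubeSquare (cubeSquare_of_canonical hC)

end Canonical

/-! ### (C) in the concrete field of singular moduli `H_K ⊂ ℂ`

The files `Literature/NumberTheory/EllipticCurves/SingularModuliWeber*.lean` prove the cube/square
structure of `(j(τ_{Q₀}))`, `(j(τ_{Q₀}) − 1728)` inside the ring of integers of the concrete field
`H_K = singularModuliField K ι ⊂ ℂ` (generated by `ι(K)` and all singular moduli of discriminant
`d_K`).  This section moves such statements onto the abstract extension `L ⊇ K` of the chain above:
the Hilbert-class-field embedding `σ : H → ℂ` has `H_K` in its range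
(`exists_ringHom_apply_eq_formJ_range`, `singularModuliField_le_fieldRange`), giving
`e : H_K → H` with `σ ∘ e = incl` and `e(j₁) = j₀`, and ideal powers are transported along `e`
(`exists_span_map_eq_pow`).  Hence the fact follows from the **H_K-form of (C)**:

  (C_H)  for `|d_K|` large, every `ι : K → ℂ` and `j₁ ∈ 𝓞_{H_K}` over `j(τ_{d_K})`:
         `(j₁) = 𝔞³` and `(j₁ − 1728) = 𝔟²` in `𝓞_{H_K}`.
-/

section SingularModuliField

open NumberField
open _root_.Literature.NumberTheory.NumberFields (exists_hilbertClassField_data)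
open _root_.Literature.NumberTheory.QuadraticFields.Quadratic (discr_emod_four)

/-- **From (C_H) to the unramified cube/square data** of `.of_unramified_cubeSquare`: the Hilbert class
field `H` of `K` (tree CFT, `exists_hilbertClassField_data`), its embedding `σ : H → ℂ` covering
`H_K` with `σ(j₀) = j(τ_{d_K})`, the embedding `e : H_K → H`, and transport of the factorizations of
`(j₁)`, `(j₁ − 1728)` from `𝓞_{H_K}` to `𝓞_H`. [cite: Cox2013, §8.A Thm. 8.10, §11.A Thm. 11.1, §12.A Thm. 12.2] [cite: GranvilleStark2000, §2 Lemma 1] -/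
theorem cubeSquareData_of_singularModuliField
    (hCH : ∃ d₁ : ℝ, ∀ (K : Type) [Field K] [NumberField K], IsImaginaryQuadratic K →
      d₁ ≤ |(NumberField.discr K : ℝ)| →
      ∀ (ι : K →+* ℂ) (j₁ : 𝓞 (singularModuliField K ι)),
        ((j₁ : singularModuliField K ι) : ℂ) = formJ (principalForm (NumberField.discr K)) →
        (∃ 𝔞 : Ideal (𝓞 (singularModuliField K ι)), Ideal.span {j₁} = 𝔞 ^ 3) ∧
        (∃ 𝔟 : Ideal (𝓞 (singularModuliField K ι)), Ideal.span {j₁ - 1728} = 𝔟 ^ 2)) :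
    ∃ d₁ : ℝ, ∀ (K : Type) [Field K] [NumberField K],
      Module.finrank ℚ K = 2 → NumberField.InfinitePlace.nrRealPlaces K = 0 →
      d₁ ≤ |(NumberField.discr K : ℝ)| →
        ∃ (L : Type) (_ : Field L) (_ : NumberField L) (_ : Algebra K L) (σ : L →+* ℂ) (j₀ : 𝓞 L)
          (𝔞 𝔟 : Ideal (𝓞 L)),
          σ j₀ = formJ (principalForm (NumberField.discr K)) ∧
          (∀ (P : Ideal (𝓞 L)) [P.IsMaximal], Algebra.IsUnramifiedAt (𝓞 K) P) ∧
          Ideal.span {j₀} = 𝔞 ^ 3 ∧ Ideal.span {j₀ - 1728} = 𝔟 ^ 2 := by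
  obtain ⟨d₁, hC⟩ := hCH
  refine ⟨d₁, fun K _ _ h2 h0 hd ↦ ?_⟩
  have hK : IsImaginaryQuadratic K := ⟨h2, NumberField.nrRealPlaces_eq_zero_iff.mp h0⟩
  obtain ⟨H, hfd, hgal, hunr, hspl⟩ := exists_hilbertClassField_data K
  haveI := hfd
  haveI := hgal
  haveI : NumberField H := NumberField.of_module_finite K H
  obtain ⟨σ, j₀, hσ, hroots⟩ := exists_ringHom_apply_eq_formJ_range K hK H hspl
  set ι : K →+* ℂ := σ.comp (algebraMap K H) with hι
  have hle : singularModuliField K ι ≤ σ.fieldRange :=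
    singularModuliField_le_fieldRange (K := K) σ hroots
  obtain ⟨e, he⟩ := exists_ringHom_singularModuliField_comp_eq σ hle
  -- `j₁ ∈ 𝓞 H_K` over `j(τ_{d_K})`
  set D := NumberField.discr K with hDdef
  have hD : D < 0 := hK.discr_neg
  have h4 : D % 4 = 0 ∨ D % 4 = 1 := discr_emod_four h2
  have hP1 : 0 < (principalForm D).1 := by rw [principalForm_fst]; exact one_pos
  have hmem : formJ (principalForm D) ∈ singularModuliField K ι :=
    formJ_mem_singularModuliField ι hP1 (isPrimitive_principalForm D) (discr_principalForm h4) hD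
  have hint : IsIntegral ℤ (formJ (principalForm D)) :=
    isIntegral_int_formJ hP1 (isPrimitive_principalForm D) (by rw [discr_principalForm h4]; exact hD)
  have hintS : IsIntegral ℤ (⟨formJ (principalForm D), hmem⟩ : singularModuliField K ι) :=
    (isIntegral_algHom_iff (singularModuliField K ι).subtype.toIntAlgHom Subtype.val_injective).mp
      hint
  set j₁ : 𝓞 (singularModuliField K ι) := ⟨⟨formJ (principalForm D), hmem⟩, hintS⟩ with hj₁
  obtain ⟨⟨𝔞, h𝔞⟩, ⟨𝔟, h𝔟⟩⟩ := hC K hK hd ι j₁ rfl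
  -- transport along `e' : 𝓞 H_K → 𝓞 H`, `e' j₁ = j₀`
  set e' : 𝓞 (singularModuliField K ι) →+* 𝓞 H := RingOfIntegers.mapRingHom e with he'
  have hej : e' j₁ = j₀ := by
    apply RingOfIntegers.ext
    apply σ.injective
    rw [he', RingOfIntegers.mapRingHom_apply, he]
    exact hσ.symm
  obtain ⟨𝔞', h𝔞'⟩ := exists_span_map_eq_pow e' ⟨𝔞, h𝔞⟩
  obtain ⟨𝔟', h𝔟'⟩ := exists_span_map_eq_pow e' ⟨𝔟, h𝔟⟩
  rw [hej] at h𝔞'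
  rw [map_sub, map_ofNat, hej] at h𝔟'
  exact ⟨H, inferInstance, inferInstance, inferInstance, σ, j₀, 𝔞', 𝔟', hσ, hunr, h𝔞', h𝔟'⟩

/-- **`OWeakUniformABCImpliesNoSiegelZeros` from (C_H)** — the cube/square structure of `(j(τ_{d_K}))`,
`(j(τ_{d_K}) − 1728)` in the ring of integers of the concrete field of singular moduli
`H_K = singularModuliField K ι ⊂ ℂ`, for `|d_K|` large.  Proved instances of (C_H) in the tree's
`Literature/NumberTheory/EllipticCurves/SingularModuliWeber*` files: `(j₁) = (w)³` for `3 ∤ d_K`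
(`exists_span_formJ_eq_pow_three_of_not_dvd`) and `(j₁ − 1728) = 𝔟²` for odd `d_K`
(`exists_span_formJ_sub_eq_sq_of_odd`); what remains of (C_H) is the square part for even `d_K` and
the cube part for `3 ∣ d_K` (ring class fields of conductor `2`, `3`).
[cite: Tafula2021, Theorem 1.2 with Lemma 5.4] [cite: Cox2013, §12.A Thm. 12.2] [cite: GranvilleStark2000, §2 Lemma 1] -/
theorem OWeakUniformABCImpliesNoSiegelZeros.of_cubeSquare_singularModuliField
    (hCH : ∃ d₁ : ℝ, ∀ (K : Type) [Field K] [NumberField K], IsImaginaryQuadratic K →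
      d₁ ≤ |(NumberField.discr K : ℝ)| →
      ∀ (ι : K →+* ℂ) (j₁ : 𝓞 (singularModuliField K ι)),
        ((j₁ : singularModuliField K ι) : ℂ) = formJ (principalForm (NumberField.discr K)) →
        (∃ 𝔞 : Ideal (𝓞 (singularModuliField K ι)), Ideal.span {j₁} = 𝔞 ^ 3) ∧
        (∃ 𝔟 : Ideal (𝓞 (singularModuliField K ι)), Ideal.span {j₁ - 1728} = 𝔟 ^ 2)) :
    OWeakUniformABCImpliesNoSiegelZeros :=
  OWeakUniformABCImpliesNoSiegelZeros.of_unramified_cubeSquare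
    (cubeSquareData_of_singularModuliField hCH)

/-- The same for the catalogued entry `UniformABCImpliesNoSiegelZeros`. [cite: GranvilleStark2000, Theorem 2 with Lemma 1] -/
theorem UniformABCImpliesNoSiegelZeros.of_cubeSquare_singularModuliField
    (hCH : ∃ d₁ : ℝ, ∀ (K : Type) [Field K] [NumberField K], IsImaginaryQuadratic K →
      d₁ ≤ |(NumberField.discr K : ℝ)| →
      ∀ (ι : K →+* ℂ) (j₁ : 𝓞 (singularModuliField K ι)),
        ((j₁ : singularModuliField K ι) : ℂ) = formJ (principalForm (NumberField.discr K)) →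
        (∃ 𝔞 : Ideal (𝓞 (singularModuliField K ι)), Ideal.span {j₁} = 𝔞 ^ 3) ∧
        (∃ 𝔟 : Ideal (𝓞 (singularModuliField K ι)), Ideal.span {j₁ - 1728} = 𝔟 ^ 2)) :
    UniformABCImpliesNoSiegelZeros :=
  UniformABCImpliesNoSiegelZeros.of_unramified_cubeSquare (cubeSquareData_of_singularModuliField hCH)

/-- The same for Granville–Stark's Theorem 1 (`granville_stark`). [cite: GranvilleStark2000, Theorem 1 with Lemma 1] -/
theorem granville_stark_of_cubeSquare_singularModuliField
    (hCH : ∃ d₁ : ℝ, ∀ (K : Type) [Field K] [NumberField K], IsImaginaryQuadratic K →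
      d₁ ≤ |(NumberField.discr K : ℝ)| →
      ∀ (ι : K →+* ℂ) (j₁ : 𝓞 (singularModuliField K ι)),
        ((j₁ : singularModuliField K ι) : ℂ) = formJ (principalForm (NumberField.discr K)) →
        (∃ 𝔞 : Ideal (𝓞 (singularModuliField K ι)), Ideal.span {j₁} = 𝔞 ^ 3) ∧
        (∃ 𝔟 : Ideal (𝓞 (singularModuliField K ι)), Ideal.span {j₁ - 1728} = 𝔟 ^ 2)) :
    granville_stark :=
  granville_stark_of_unramified_cubeSquare (cubeSquareData_of_singularModuliField hCH)

end SingularModuliField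

/-! ### (C_H) for `gcd(d_K, 6) = 1`, and the sharpest remaining hypothesis

With `SingularModuliWeberCubeRootInert` (cube part for all `3 ∤ d_K`) and
`SingularModuliWeberSquareRootInert` (square part for all odd `d_K`), the H_K-form (C_H) is a theorem
whenever `gcd(d_K, 6) = 1`; so the fact follows from (C_H) restricted to the discriminants divisible
by `2` or `3` — the ideal-theoretic content of the ring class fields of conductor `2` and `3`
(Cox Thm. 12.2 for `3 ∣ D` is Thm. 12.13 (Schertz); `γ₃` for even `D`), which the tree does not have.
-/

section CoprimeSix

open NumberField
open _root_.Literature.NumberTheory.QuadraticFields.Quadratic (discr_emod_four)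

/-- **(C_H) holds when `gcd(d_K, 6) = 1`**: `(j₁) = (w)³` (`exists_span_formJ_eq_pow_three_of_not_dvd`,
Cox Thm. 12.2, `3 ∤ d_K`) and `(j₁ − 1728) = 𝔟²` (`exists_span_formJ_sub_eq_sq_of_odd`, odd `d_K`) in
`𝓞 H_K`, for `j₁` over `j(τ_{d_K})`. [cite: Cox2013, §12.A Thm. 12.2] -/
theorem cubeSquare_singularModuliField_of_coprime_six {K : Type} [Field K] [NumberField K]
    (hK : IsImaginaryQuadratic K) (h2 : Odd (NumberField.discr K))
    (h3 : ¬ (3 : ℤ) ∣ NumberField.discr K) (ι : K →+* ℂ) (j₁ : 𝓞 (singularModuliField K ι))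
    (hj₁ : ((j₁ : singularModuliField K ι) : ℂ) = formJ (principalForm (NumberField.discr K))) :
    (∃ 𝔞 : Ideal (𝓞 (singularModuliField K ι)), Ideal.span {j₁} = 𝔞 ^ 3) ∧
    (∃ 𝔟 : Ideal (𝓞 (singularModuliField K ι)), Ideal.span {j₁ - 1728} = 𝔟 ^ 2) := by
  have h4 : NumberField.discr K % 4 = 0 ∨ NumberField.discr K % 4 = 1 := discr_emod_four hK.1
  have hP1 : 0 < (principalForm (NumberField.discr K)).1 := by rw [principalForm_fst]; exact one_pos
  obtain ⟨w, hw⟩ := exists_span_formJ_eq_pow_three_of_not_dvd hK h3 ι hP1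
    (isPrimitive_principalForm _) (discr_principalForm h4) j₁ hj₁
  obtain ⟨𝔟, h𝔟⟩ := exists_span_formJ_sub_eq_sq_of_odd hK h2 ι hP1
    (isPrimitive_principalForm _) (discr_principalForm h4) j₁ hj₁
  exact ⟨⟨Ideal.span {w}, hw⟩, ⟨𝔟, h𝔟⟩⟩

/-- **`OWeakUniformABCImpliesNoSiegelZeros` from (C_H) for the discriminants divisible by `2` or `3`
alone** — everything else (height argument, eq. (11), class field theory for the Hilbert class field,
Deuring, Bauer, Kummer, and the Weber-function theory of `γ₂ = ∛j` for `3 ∤ d_K` and of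
`γ₃ = √(j − 1728)` for odd `d_K`) being proved in the tree.  The remaining hypothesis: for `K`
imaginary quadratic with `|d_K|` large and `2 ∣ d_K` or `3 ∣ d_K`, every `ι : K → ℂ` and `j₁ ∈ 𝓞_{H_K}`
over `j(τ_{d_K})`, `(j₁) = 𝔞³` and `(j₁ − 1728) = 𝔟²` in `𝓞_{H_K}` (for `3 ∣ d_K`, resp. even `d_K`,
only the cube, resp. square, part is open; both are asked here for a uniform statement).
[cite: Tafula2021, Theorem 1.2 with Lemma 5.4] [cite: Cox2013, §12.A Thm. 12.2, Thm. 12.13] [cite: GranvilleStark2000, §2 Lemma 1] -/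
theorem OWeakUniformABCImpliesNoSiegelZeros.of_cubeSquare_singularModuliField_two_three
    (hCH : ∃ d₁ : ℝ, ∀ (K : Type) [Field K] [NumberField K], IsImaginaryQuadratic K →
      d₁ ≤ |(NumberField.discr K : ℝ)| → ((2 : ℤ) ∣ NumberField.discr K ∨ (3 : ℤ) ∣ NumberField.discr K) →
      ∀ (ι : K →+* ℂ) (j₁ : 𝓞 (singularModuliField K ι)),
        ((j₁ : singularModuliField K ι) : ℂ) = formJ (principalForm (NumberField.discr K)) →
        (∃ 𝔞 : Ideal (𝓞 (singularModuliField K ι)), Ideal.span {j₁} = 𝔞 ^ 3) ∧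
        (∃ 𝔟 : Ideal (𝓞 (singularModuliField K ι)), Ideal.span {j₁ - 1728} = 𝔟 ^ 2)) :
    OWeakUniformABCImpliesNoSiegelZeros := by
  obtain ⟨d₁, hC⟩ := hCH
  refine OWeakUniformABCImpliesNoSiegelZeros.of_cubeSquare_singularModuliField
    ⟨d₁, fun K _ _ hK hd ι j₁ hj₁ ↦ ?_⟩
  by_cases h6 : (2 : ℤ) ∣ NumberField.discr K ∨ (3 : ℤ) ∣ NumberField.discr K
  · exact hC K hK hd h6 ι j₁ hj₁
  · obtain ⟨h2, h3⟩ := not_or.mp h6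
    have hodd : Odd (NumberField.discr K) :=
      Int.not_even_iff_odd.mp fun h ↦ h2 (even_iff_two_dvd.mp h)
    exact cubeSquare_singularModuliField_of_coprime_six hK hodd h3 ι j₁ hj₁

/-- The same for the catalogued entry `UniformABCImpliesNoSiegelZeros`. [cite: GranvilleStark2000, Theorem 2 with Lemma 1] -/
theorem UniformABCImpliesNoSiegelZeros.of_cubeSquare_singularModuliField_two_three
    (hCH : ∃ d₁ : ℝ, ∀ (K : Type) [Field K] [NumberField K], IsImaginaryQuadratic K →
      d₁ ≤ |(NumberField.discr K : ℝ)| → ((2 : ℤ) ∣ NumberField.discr K ∨ (3 : ℤ) ∣ NumberField.discr K) →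
      ∀ (ι : K →+* ℂ) (j₁ : 𝓞 (singularModuliField K ι)),
        ((j₁ : singularModuliField K ι) : ℂ) = formJ (principalForm (NumberField.discr K)) →
        (∃ 𝔞 : Ideal (𝓞 (singularModuliField K ι)), Ideal.span {j₁} = 𝔞 ^ 3) ∧
        (∃ 𝔟 : Ideal (𝓞 (singularModuliField K ι)), Ideal.span {j₁ - 1728} = 𝔟 ^ 2)) :
    UniformABCImpliesNoSiegelZeros :=
  UniformABCImpliesNoSiegelZeros.of_oWeak
    (OWeakUniformABCImpliesNoSiegelZeros.of_cubeSquare_singularModuliField_two_three hCH)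

end CoprimeSix

/-! ### (C_H) for every discriminant, and the theorem

The remaining discriminants (`2 ∣ d_K` or `3 ∣ d_K`) are supplied by the ring class fields of
conductor `2` and `3` in their H_K-form: `3 ∣ v_𝔓(j₁)` at the primes `𝔓 ∌ 3` (Weber's `γ₂` at a CM point
of level `9`, `SingularModuliCubeSquareAwayFromSix.three_dvd_count_span_formJ`) and at the primes
`𝔓 ∌ 2` (the level-`2` Hauptmodul `s = Δ(τ)/Δ(2τ)`, `j(2τ)s = (s+16)³`,
`SingularModuliCubeAwayFromTwo.three_dvd_count_span_formJ_of_two_not_mem`); `2 ∣ v_𝔓(j₁ − 1728)` at the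
primes `𝔓 ∌ 2` (Weber's `γ₃` at level `4`, `two_dvd_count_span_formJ_sub`) and at the primes `𝔓 ∌ 3`
(the level-`3` Hauptmodul `t = (η/η₃)¹²`, `(j(3τ) − 1728)t = (t² + 18t − 27)²`,
`SingularModuliSquareAwayFromThree.two_dvd_count_span_formJ_sub_of_three_not_mem`) — each through a
CM extension of `H_K` unramified at the prime in question (`SingularModuliRingClassUnramified`, Deuring's
congruence `π ≡ 1 (mod f)` and class field theory for ray class characters).  Every prime misses `2`
or `3`, so all exponents of `(j₁)` are divisible by `3` and all exponents of `(j₁ − 1728)` by `2`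
(`exists_span_eq_pow_of_forall_count_dvd`).
-/

section AllDiscriminants

open NumberField IsDedekindDomain
open _root_.Literature.NumberTheory.NumberFields (exists_span_eq_pow_of_forall_count_dvd)

/-- A maximal ideal of a ring of integers cannot contain both `2` and `3`. [folklore] -/
theorem not_mem_two_of_mem_three {F : Type*} [Field F] [NumberField F] (v : HeightOneSpectrum (𝓞 F))
    (h3 : ((3 : ℕ) : 𝓞 F) ∈ v.asIdeal) : ((2 : ℕ) : 𝓞 F) ∉ v.asIdeal := by
  intro h2
  apply v.isPrime.ne_top
  rw [Ideal.eq_top_iff_one]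
  have h := v.asIdeal.sub_mem h3 h2
  have h1 : ((3 : ℕ) : 𝓞 F) - ((2 : ℕ) : 𝓞 F) = 1 := by push_cast; norm_num
  rwa [h1] at h

/-- **(C_H) for every imaginary quadratic field `K`**: in `𝓞 H_K`, `H_K = singularModuliField K ι`, the
ideal `(j₁)` is a cube and `(j₁ − 1728)` is a square, `j₁` over `j(τ_{d_K})` — the ideal-theoretic
content of Weber's `γ₂ = ∛j`, `γ₃ = √(j − 1728)` (Cox Thm. 12.2 and §12.B) completed at the
discriminants divisible by `2` or `3` by the ring class fields of conductor `2`, `3`.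
[cite: Cox2013, §12.A Thm. 12.2 and §12.B] [cite: GranvilleStark2000, §2 Lemma 1 (ideal form)] -/
theorem cubeSquare_singularModuliField {K : Type} [Field K] [NumberField K] (hK : IsImaginaryQuadratic K)
    (ι : K →+* ℂ) (j₁ : 𝓞 (singularModuliField K ι))
    (hj₁ : ((j₁ : singularModuliField K ι) : ℂ) = formJ (principalForm (NumberField.discr K))) :
    (∃ 𝔞 : Ideal (𝓞 (singularModuliField K ι)), Ideal.span {j₁} = 𝔞 ^ 3) ∧
    (∃ 𝔟 : Ideal (𝓞 (singularModuliField K ι)), Ideal.span {j₁ - 1728} = 𝔟 ^ 2) := by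
  haveI : NumberField (singularModuliField K ι) :=
    numberField_singularModuliField irreducible_classPolynomial_holds hK ι
  constructor
  · by_cases h0 : j₁ = 0
    · exact ⟨⊥, by rw [h0, Ideal.span_singleton_eq_bot.mpr rfl, ← Ideal.zero_eq_bot, zero_pow three_ne_zero]⟩
    · refine exists_span_eq_pow_of_forall_count_dvd h0 fun v ↦ ?_
      by_cases h3 : ((3 : ℕ) : 𝓞 (singularModuliField K ι)) ∈ v.asIdeal
      · exact three_dvd_count_span_formJ_of_two_not_mem hK ι j₁ hj₁ h0 v (not_mem_two_of_mem_three v h3)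
      · exact three_dvd_count_span_formJ hK ι j₁ hj₁ h0 v h3
  · by_cases h0 : j₁ - 1728 = 0
    · exact ⟨⊥, by rw [h0, Ideal.span_singleton_eq_bot.mpr rfl, ← Ideal.zero_eq_bot, zero_pow two_ne_zero]⟩
    · refine exists_span_eq_pow_of_forall_count_dvd h0 fun v ↦ ?_
      by_cases h3 : ((3 : ℕ) : 𝓞 (singularModuliField K ι)) ∈ v.asIdeal
      · exact two_dvd_count_span_formJ_sub hK ι j₁ hj₁ h0 v (not_mem_two_of_mem_three v h3)
      · exact two_dvd_count_span_formJ_sub_of_three_not_mem hK ι j₁ hj₁ h0 v h3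

/-- (C_H) in the quantified shape consumed by `OWeakUniformABCImpliesNoSiegelZeros.of_cubeSquare_singularModuliField`
(no lower bound on `|d_K|` is needed). [cite: Cox2013, §12.A Thm. 12.2 and §12.B] -/
theorem cubeSquare_singularModuliField_all :
    ∃ d₁ : ℝ, ∀ (K : Type) [Field K] [NumberField K], IsImaginaryQuadratic K →
      d₁ ≤ |(NumberField.discr K : ℝ)| →
      ∀ (ι : K →+* ℂ) (j₁ : 𝓞 (singularModuliField K ι)),
        ((j₁ : singularModuliField K ι) : ℂ) = formJ (principalForm (NumberField.discr K)) →
        (∃ 𝔞 : Ideal (𝓞 (singularModuliField K ι)), Ideal.span {j₁} = 𝔞 ^ 3) ∧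
        (∃ 𝔟 : Ideal (𝓞 (singularModuliField K ι)), Ideal.span {j₁ - 1728} = 𝔟 ^ 2) :=
  ⟨0, fun _ _ _ hK _ ι j₁ hj₁ ↦ cubeSquare_singularModuliField hK ι j₁ hj₁⟩

/-- **Granville–Stark's CM input, unramified form (PROVED)**: for every imaginary quadratic `K` a number
field `L ⊇ K` unramified over `𝓞_K` (the Hilbert class field), a complex embedding `σ`, `j₀ ∈ 𝓞_L` over
`j(τ_{d_K})` and ideals with `(j₀) = 𝔞³`, `(j₀ − 1728) = 𝔟²` — verbatim the statement of
`GranvilleStark.exists_unramified_cubeSquare_singularModulus` and the hypothesis of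
`granville_stark_of_unramified_cubeSquare`. [cite: GranvilleStark2000, §2 Lemma 1] [cite: Cox2013, Thm. 11.1 and Thm. 12.2] -/
theorem exists_unramified_cubeSquare_singularModulus_all :
    ∃ d₁ : ℝ, ∀ (K : Type) [Field K] [NumberField K],
      Module.finrank ℚ K = 2 → NumberField.InfinitePlace.nrRealPlaces K = 0 →
      d₁ ≤ |(NumberField.discr K : ℝ)| →
        ∃ (L : Type) (_ : Field L) (_ : NumberField L) (_ : Algebra K L) (σ : L →+* ℂ) (j₀ : 𝓞 L)
          (𝔞 𝔟 : Ideal (𝓞 L)),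
          σ j₀ = formJ (principalForm (NumberField.discr K)) ∧
          (∀ (P : Ideal (𝓞 L)) [P.IsMaximal], Algebra.IsUnramifiedAt (𝓞 K) P) ∧
          Ideal.span {j₀} = 𝔞 ^ 3 ∧ Ideal.span {j₀ - 1728} = 𝔟 ^ 2 :=
  cubeSquareData_of_singularModuliField cubeSquare_singularModuliField_all

/-- **Táfula 2021, Theorem 1.2 / Granville–Stark 2000, Theorem 2 in the `O`-weak form (PROVED):
`O`-weak uniform `abc` for number fields ⟹ no Siegel zeros for odd negative fundamental
discriminants.**  The discharge of the barrier entry `OWeakUniformABCImpliesNoSiegelZeros`: the height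
argument (Táfula Lemma 5.5), Granville–Stark's eq. (11), Mahler's equivalence and class field theory
were proved in this file; the CM input (Lemma 1 / Táfula Lemma 5.4) is `cubeSquare_singularModuliField_all`.
[cite: Tafula2021, Theorem 1.2 with Lemmas 5.4–5.5] [cite: GranvilleStark2000, Theorem 2 and §2 Lemma 1] -/
theorem OWeakUniformABCImpliesNoSiegelZeros_holds : OWeakUniformABCImpliesNoSiegelZeros :=
  OWeakUniformABCImpliesNoSiegelZeros.of_cubeSquare_singularModuliField cubeSquare_singularModuliField_all

/-- **Granville–Stark 2000, Theorem 2 (PROVED): the uniform `abc`-conjecture for number fields implies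
no Siegel zeros for `L(s, (−d/·))`, `−d` odd fundamental** — the discharge of the catalogued entry
`UniformABCImpliesNoSiegelZeros`. [cite: GranvilleStark2000, Theorem 2] -/
theorem UniformABCImpliesNoSiegelZeros_holds : UniformABCImpliesNoSiegelZeros :=
  UniformABCImpliesNoSiegelZeros.of_cubeSquare_singularModuliField cubeSquare_singularModuliField_all

/-- **Granville–Stark 2000, Theorem 1 (PROVED): uniform `abc` ⟹ `h(−d) ≥ (π/3 + o(1))√d/log d · Σ' 1/a`**
(`granville_stark` of `AbcWave0.lean`). [cite: GranvilleStark2000, Theorem 1] -/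
theorem granville_stark_of_cubeSquare_all : granville_stark :=
  granville_stark_of_cubeSquare_singularModuliField cubeSquare_singularModuliField_all

end AllDiscriminants

end Literature.Barriers.ABC

end
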